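import Literature.MathematicalPhysics.QuantumFieldTheory.Balaban1983to89.B8Prop5JoinHFP

/-!
# `Balaban1983to89.B8Prop5UniqKLevel` — T. Bałaban, *Spaces of regular gauge field configurations on a lattice and gauge fixing conditions*,
# Commun. Math. Phys. **99** (1985) 75–102 [Balaban1985RegularSpaces] ("B8"), PROPOSITION 5 p. 94, THE UNIQUENESS CLAUSE (1.109) AT `k` LEVELS
# ON THE CONCRETE `ℤᵈ × 𝔸` CARRIERS — the CONVERSE of the join `B8Prop5JoinHFP` («JOIN-B»): every gauge parameter in the (1.109)-ball that
# satisfies the two clauses of (1.107) in the knit's currency IS the gauge parameter of THE fixed point of (1.100), hence is unique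

statement-level skeleton of published theorems with citation tags; proofs where landed; nothing here is a claim about the
Yang–Mills mass gap

PDF held: `paper:balaban1985-cmp99-regular-spaces-gauge-fixing` (journal page = PDF page + 74); pp. 92–97 [PDF 18–23] read on the text layer by
this seat (2026-08-26).

WHAT IS PRINTED (p. 94, verbatim): "Proposition 5. There exist positive constants c₂, c₃, depending on d and L only, such that for an arbitrary
configuration U₁ satisfying (1.69), and for the configuration u₁ determined by U₁ and satisfying (1.68), (1.73), (1.74), if α₀ + α₁ ≤ c₂, then
there exists a configuration u′ = e^{iλ} satisfying the equations … (1.107) and the bounds … (1.108).  Such a configuration u′ is unique in the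
domain |λ|, |Dλ|₍₋₁₎ < c₃. (1.109)  The part of this proposition concerning the existence of u′ was proved completely.  The uniqueness follows
from the fact that the image of a set {λ : |λ|, |D_{u₁}λ|₍₋₁₎ < α₄′} by the transformation λ ↦ λ − H′D′(u₁, λ) contains the set {λ′ : |λ′|,
|Dλ′|₍₋₁₎ < ½α₄} for α₄ sufficiently small.  This follows from results of the next section."; p. 93: "Equations (1.95) can be changed into the
equivalent equation λ = G′RD*A + G′R𝔉₄(λ, Dλ, A, D*A). (1.100) … Of course (1.95) imply (1.100)."; p. 92: "(I + RVR)⁻¹ = I + Σ (−1)ⁿR(VR)ⁿ.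
(1.96) … We assume that α₄ is so small that O(α₄)B′₀² ≤ ½.  Then the operator in the square bracket in (1.94) is invertible."

WHY THIS FILE (cell `pub-ymgap`, HUMAN RULING D-0062; dag-lead REACTIVATE №14 / REBALANCE №50 = `pub-ymgap-dag-n05-a`'s LOCATED-2 «the
`SockP5u` provider — the ONE N05 socket with no hand»; seat `pub-ymgap-dag-n04-b` g5).  The lineage proved the EXISTENCE half of Proposition 5
at `k` levels in three joins: the contraction (`B8Prop5ContractionKLevel.propFive_fixedPoint_kLevel`, with its `∃!`), the gauge parameter
`λ′ = λ + H_cλ` (`B8Prop5GaugeParamKLevel`), and the passage fixed point ⇒ (1.107) in the knit's currency `HFP` (`B8Prop5JoinHFP.hFP_kLevel_of179`: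
the MULTIPLIER FORM of the Landau equation (1.38) for `U₁^{(e^{iλ′})⁻¹}` + (1.29) for `u₁·e^{iλ′}`).  The uniqueness clause (1.109) — consumed by
Theorem 4's «exactly one u» (p. 95, `B8Thm4UniqueLocal`) — needs the CONVERSE passage: a `λ′` in the (1.109)-ball obeying the two (1.107) clauses
comes from a point of the ¼α₄-ball that satisfies the fixed-point equation of (1.100), whereupon the contraction's `∃!` identifies it.  That
converse is print's last paragraph of p. 94 read with pp. 92–93 backwards, and is typed here.

WHAT THIS FILE PROVES (kernel, 0 sorry, theorems only; `𝔸` a nontrivial C⋆-algebra; ON THE `Ω 0 = univ` SUB-FAMILY, see READING (i)).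
* §1 **`sectE_inverse_kLevel`** — «the image of {λ : |λ|, |Dλ|₍₋₁₎ < α₄′} by λ ↦ λ − H′D′(u₁, λ) contains {λ′ : … < ½α₄}» in the tree's
  currency: for a correction `H_c` of sizes `h₀, h₁` and Lipschitz moduli `l₀, l₁ ≤ ½` on the ¼α₄-ball of the space (1.102)
  (`B8LambdaSpaceKLevel.lamSubK`), every `λ′` with `|λ′| ≤ ρ`, `|Dλ′|₍₋₁₎ ≤ ρ` on the bonds `Eb j`, `ρ + h₀, ρ + h₁ ≤ ¼α₄`, is `λ_t + H_cλ_t` for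
  a point `t` of the ball (Banach, `B8SectDSource.fixedPoint_closedBall` for `t ↦ λ′ − H_cλ_t`).
* §2 `bd2_covLap_lamOf` (a crude `|Δλ_t|₍₋₂₎ ≤ 2dLᵏ‖t‖`), **`neumann_injective`** — the injectivity half of (1.96): `D = −R(V D)` on the `Ω_j`
  with `|D|₍₋₂₎ < ∞`, `|V| ≤ c_V`, `|R|₍₋₂₎ ≤ B_R`, `c_VB_R ≤ ½` ⇒ `D = 0` on the `Ω_j`.
* §3 `proj325_eq_zero_of_multiplier'` — «R f = 0 ⟸ Δf = Q′*μ» for `R = I − G′Q′*CQ′G′` ((3.25) of [4]) from `g_left` and the LEFT-inverse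
  law of `C` in the range form `c_left' : Q′*·C·(Q′G′²Q′*) = Q′*` (`B8Eq138Multiplier.proj325_apply_eq_zero_iff_exists` uses the full-space form).
* §4 **`isFixedPoint_of_HFP`** — THE CONVERSE OF JOIN-B: under JOIN-B/C's displayed letters, correction `H_c`, datum and windows, plus the four
  extras below, a `λ′` with `|λ′| ≤ ρ` everywhere, `(Lʲη)|Dλ′| ≤ ρ` on the `Eb j`, the multiplier clause of `HFP` and `Restr129 L k Λs U₀
  (u₁·e^{iλ′})` is `λ_t + H_cλ_t` for a `t` in the ¼α₄-ball with `λ_t = G′(Ψλ_t)` — the fixed-point equation of `propFive_fixedPoint_kLevel`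
  LITERALLY.  Route: §1; (1.29) ⇒ (1.79) for the inverse pair (`restr129_mul_iff_inv_mul`, `restr129_mul_iff_cond179`) ⇒ `Q′λ_t = 0` by (1.114)
  in its converse printed use (`h114q`); multiplier ⇒ `R N = 0` (§3) for the D*-identity's right-hand side `N = W + Δλ_t + V(Δλ_t)`
  (`B8Prop5KLevelLetters.dstar_rhs_eq_W_add`); `RΔλ_t = Δλ_t` (`g_left`, `Q′λ_t = 0`); the Neumann identity `Z + V(RZ) = W` (`zsol_eq`); hence
  `D := Δλ_t + RZ` obeys `D = −RV D`, so `D = 0` (§2) and `Δλ_t = R(−Z)`; finally `λ_t = G′Δλ_t = G′R(−Z)` (`g_left`) — «Of course (1.95) imply (1.100)».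
* §5 **`hFP_unique_kLevel`** — PROPOSITION 5 (1.109) AT `k` LEVELS IN THE KNIT'S CURRENCY: two such `λ′` coincide (the `∃!` of
  `propFive_fixedPoint_kLevel` at `gpar λ = λ + H_cλ`, `Eterm λ = ΔH_cλ`, as in `B8Prop5GaugeParamKLevel.gaugeParam_kLevel`).

DISPLAYED HYPOTHESES (each named for its source; JOIN-B/C's by the same names: letters `g Δ q qs Aw c` with `g_left`, readings `hΔ`/`hqs`; `H_c`
binders `hc0 hc1 hc2 hcL0 hcL1 hcL2`; (1.101) `hG`, (1.98)R `hRbd`; datum `hDA`/`hA`; windows `ha₁' hb₁' hb₁ hθ`, (1.103) `h103`, (1.106) `h106`;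
[3] Prop. 10 inputs `hdom`/`h167` for the inverse pair, (1.29) for `u₁⁻¹`, `β`-smallness) PLUS FOUR EXTRAS: `c_left'` ([4] (3.25): C is a
two-sided inverse — JOIN-B needs only `c_right`); `h114q` = Sect. E's (1.114) in its CONVERSE printed use «`Q′(u₁⁻¹, (e^{iλ′})⁻¹) = 0` on `𝔅_k`
⇒ `Q′λ = 0`» (the converse of JOIN-B v1.1's `h179`; from (1.114) for a `Q′`-letter vanishing off `𝔅_k`); the inversion windows `l₀, l₁ ≤ ½`,
`ρ + h₀ ≤ ¼α₄`, `ρ + h₁ ≤ ¼α₄` (JOIN-C's `h₀ = h₁ = B′₀C′₂(α₃ + α₄)α₄ ≤ ⅛α₄` by `B8DprimeKLevelLipschitz.smallness_prod`, so `ρ = ⅛α₄` fits = print's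
c₃); and `hΩ0 : Ω 0 = univ`.

READINGS / HONEST SCOPE.  (i) `Ω 0 = univ` — the sub-family of record of the N05 knit (`B8LeafKnitZd3B9All.b8LeafRS_zd3_univ_b9all`): the
identity «Δλ = R(−Z)» behind (1.95) ⇔ (1.100) is an identity of FULL vectors of the letter algebra, which the Dirichlet letters of a proper
`Ω₀ ⊂ ℤᵈ` cannot honour off `Ω₀` in the tree's «letters on all functions» typing (there `g_left` with `hGsupp` is satisfiable only at
`Ω 0 = univ`); at `univ` the readings `hΔ`/`hqs` pin `Δ`, `Q′*` everywhere.  (ii) The solutions are compared as plain site functions `λ′` with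
`|λ′| ≤ ρ` at EVERY site and `(Lʲη)|Dλ′| ≤ ρ` on every bond of `Eb j` — print's domain (1.109) «|λ|, |Dλ|₍₋₁₎ < c₃» (sup norms over `Ω₀ = ℤᵈ`
and the bonds of `Ω_j`); reality of `λ′` is not needed for uniqueness (the contraction is complex, p. 93).  (iii) No smallness is optimised;
`c₃ = ρ` is any radius with `ρ + h₀, ρ + h₁ ≤ ¼α₄`.  NOT CLAIMED: the existence half (JOIN-A/B/C), anything of [4] or of Sect. E (displayed),
the socket `B8LeafModelZd.SockP5u` itself (whose datum/carrier/currency clauses differ from print's — recorded on the cell's bus, LOCATED-1 of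
this seat; the member-level provider is a sequel).  Count-neutral; N05 NOT discharged; nothing continuum / ℝ⁴ / OS / mass-gap / Clay.
Unit `pub-ymgap-dag-n04-b` (g5), 2026-08-26.  Tree API by name only, nothing restated.
-/

noncomputable section

open NormedSpace Metric Set Filter Topology
open Complex (I)

namespace Literature.MathematicalPhysics.QuantumFieldTheory.Balaban1983to89.B8Prop5UniqKLevel

open B7Prop1Explicit (e U1)
open B7Prop2Explicit (unitaryUnits unitaryUnits_le_U1)
open B7Eq78Linearization (conjR)
open B7Eq167Flat (Cond167)
open B8Ineq132 (covDerivFwd covDeriv norm_conjR)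
open B8Eq119TwistedAxial (Restr129)
open B8Eq138LandauZd (covLap covDivB QT covLap_zero)
open B8Eq178Averages (util178 Qnl Cond179 restr129_mul_iff_cond179)
open B8Eq182Proof (gAd)
open B8Eq184Proof (gaugeExp)
open B8Eq188Proof (frakF3 gAd_neg gAd_add)
open B8SectDSource (fixedPoint_closedBall)
open B8LambdaSpaceKLevel (wt wt_pos wt_nonneg lamSubK lamOf lamOf_sub norm_lamOf_le weight_mul_norm_covDerivFwd_le mkLam lamOf_mkLam
  norm_mkLam_le norm_le_iff norm_sub_le_iff covDerivFwd_add' covDerivFwd_sub')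
open B8Prop5ContractionKLevel (Bd2 Zsol Vop Wsrc PsiP5 Mc Kc mWc mWc_nonneg propFive_fixedPoint_kLevel zsol_eq bd2_zsol Vop_sub norm_Vop_le
  wt_sq_norm_Wsrc_le)
open B8Prop5GaugeParamKLevel (gpar_size gpar_grad gpar_lip norm_covDeriv_eq)
open B8Prop5KLevelLetters (dstar_rhs_eq_W_add covLap_sub)
open B8Restr129Inversion (restr129_mul_iff_inv_mul)
open B8Eq195Linear (proj325_sub)
open B8Prop5JoinHFP (covLap_neg')

-- `Site` alone could resolve to the torus sites of `Setup.lean`; re-export the `ℤ^d` sites of `B7Prop1Explicit`.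
export B7Prop1Explicit (Site)

variable {d : ℕ} {𝔸 : Type*} [CStarAlgebra 𝔸] [Nontrivial 𝔸]

/-! ## §1 The inverse change of variables: every small `λ′` is `λ_t + H_cλ_t` for a point `t` of the ¼α₄-ball -/

section Inverse

variable {L k : ℕ} {η : ℝ} {Eb : ℕ → Set (Site d × Fin d)} {U₀ : Site d → Fin d → 𝔸ˣ}

omit [Nontrivial 𝔸] in
/-- **«The image of {λ : |λ|, |D_{u₁}λ|₍₋₁₎ < α₄′} by λ ↦ λ − H′D′(u₁, λ) contains {λ′ : |λ′|, |Dλ′|₍₋₁₎ < ½α₄}»** (p. 94, last paragraph;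
p. 97 «onto») in the currency of the space (1.102): for a correction `H_c` (print's `−H′D′(u₁, ·)`, the tree's `λ′ = λ + H_cλ`) of sup size `h₀`
and `Eb`-weighted gradient size `h₁` on the closed ¼α₄-ball, Lipschitz there with moduli `l₀, l₁ ≤ ½`, and any site function `λ′` with `‖λ′‖ ≤ ρ`
everywhere and `(Lʲη)‖D^η_{U₀}λ′‖ ≤ ρ` on the bonds `Eb j` (`j ≤ k`), where `ρ + h₀ ≤ ¼α₄`, `ρ + h₁ ≤ ¼α₄`: THERE IS `t` in the ¼α₄-ball with
`λ_t + H_cλ_t = λ′` (the fixed point of the ½-contraction `t ↦ λ′ − H_cλ_t`, Banach). [cite: Balaban1985RegularSpaces, p.94 (after (1.109)), p.97 (after (1.125)), (1.113) p.95, (1.102) p.93] -/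
theorem sectE_inverse_kLevel (hη : 0 < η) (Hc : (Site d → 𝔸) → (Site d → 𝔸)) {α₄ h₀ h₁ l₀ l₁ ρ : ℝ}
    (hh₀ : 0 ≤ h₀) (hl₀' : l₀ ≤ 1 / 2) (hl₁' : l₁ ≤ 1 / 2) (hρ₀ : ρ + h₀ ≤ α₄ / 4) (hρ₁ : ρ + h₁ ≤ α₄ / 4)
    (hc0 : ∀ s : lamSubK η U₀ L k Eb, ‖s‖ ≤ α₄ / 4 → ∀ x, ‖Hc (lamOf s) x‖ ≤ h₀)
    (hc1 : ∀ s : lamSubK η U₀ L k Eb, ‖s‖ ≤ α₄ / 4 → ∀ j, j ≤ k → ∀ p ∈ Eb j, wt L η j * ‖covDerivFwd η U₀ p.2 (Hc (lamOf s)) p.1‖ ≤ h₁)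
    (hcL0 : ∀ s t : lamSubK η U₀ L k Eb, ‖s‖ ≤ α₄ / 4 → ‖t‖ ≤ α₄ / 4 → ∀ x, ‖Hc (lamOf s) x - Hc (lamOf t) x‖ ≤ l₀ * ‖s - t‖)
    (hcL1 : ∀ s t : lamSubK η U₀ L k Eb, ‖s‖ ≤ α₄ / 4 → ‖t‖ ≤ α₄ / 4 → ∀ j, j ≤ k → ∀ p ∈ Eb j,
      wt L η j * ‖covDerivFwd η U₀ p.2 (Hc (lamOf s) - Hc (lamOf t)) p.1‖ ≤ l₁ * ‖s - t‖)
    {lam : Site d → 𝔸} (hlρ : ∀ x, ‖lam x‖ ≤ ρ)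
    (hDρ : ∀ j, j ≤ k → ∀ p ∈ Eb j, wt L η j * ‖covDerivFwd η U₀ p.2 lam p.1‖ ≤ ρ) :
    ∃ t : lamSubK η U₀ L k Eb, ‖t‖ ≤ α₄ / 4 ∧ lamOf t + Hc (lamOf t) = lam := by
  classical
  -- the two printed members of `λ′ − H_cλ_t` on the ball
  have ha : ∀ t : lamSubK η U₀ L k Eb, ‖t‖ ≤ α₄ / 4 → ∀ x, ‖(lam - Hc (lamOf t)) x‖ ≤ ρ + h₀ := fun t ht x => by
    rw [Pi.sub_apply]
    exact (norm_sub_le _ _).trans (add_le_add (hlρ x) (hc0 t ht x))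
  have hb : ∀ t : lamSubK η U₀ L k Eb, ‖t‖ ≤ α₄ / 4 → ∀ j, j ≤ k → ∀ p ∈ Eb j,
      wt L η j * ‖covDerivFwd η U₀ p.2 (lam - Hc (lamOf t)) p.1‖ ≤ ρ + h₁ := fun t ht j hj p hp => by
    have hw : 0 ≤ wt L η j := wt_nonneg L hη.le j
    rw [covDerivFwd_sub']
    calc wt L η j * ‖covDerivFwd η U₀ p.2 lam p.1 - covDerivFwd η U₀ p.2 (Hc (lamOf t)) p.1‖
        ≤ wt L η j * (‖covDerivFwd η U₀ p.2 lam p.1‖ + ‖covDerivFwd η U₀ p.2 (Hc (lamOf t)) p.1‖) :=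
          mul_le_mul_of_nonneg_left (norm_sub_le _ _) hw
      _ ≤ ρ + h₁ := by rw [mul_add]; exact add_le_add (hDρ j hj p hp) (hc1 t ht j hj p hp)
  -- the map `t ↦ λ′ − H_cλ_t` on the ball (and `0` off it, never used)
  set T : lamSubK η U₀ L k Eb → lamSubK η U₀ L k Eb := fun t =>
    if ht : ‖t‖ ≤ α₄ / 4 then mkLam hη.le (lam - Hc (lamOf t)) (ha t ht) (hb t ht) else 0 with hT
  have hTlam : ∀ t : lamSubK η U₀ L k Eb, ‖t‖ ≤ α₄ / 4 → lamOf (T t) = lam - Hc (lamOf t) := fun t ht => by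
    simp only [hT, dif_pos ht, lamOf_mkLam]
  have hmaps : ∀ t : lamSubK η U₀ L k Eb, ‖t‖ ≤ α₄ / 4 → ‖T t‖ ≤ α₄ / 4 := fun t ht => by
    simp only [hT, dif_pos ht]
    exact (norm_mkLam_le hη.le _ (ha t ht) (hb t ht)).trans (max_le hρ₀ hρ₁)
  have hlip : ∀ s t : lamSubK η U₀ L k Eb, ‖s‖ ≤ α₄ / 4 → ‖t‖ ≤ α₄ / 4 → ‖T s - T t‖ ≤ 1 / 2 * ‖s - t‖ := by
    intro s t hs ht
    have hδ : 0 ≤ ‖s - t‖ := norm_nonneg _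
    refine (norm_sub_le_iff hη.le (T s) (T t) (by positivity)).2 ⟨fun x => ?_, fun j hj p hp => ?_⟩
    · rw [hTlam s hs, hTlam t ht, Pi.sub_apply, Pi.sub_apply, sub_sub_sub_cancel_left, norm_sub_rev]
      exact (hcL0 s t hs ht x).trans (mul_le_mul_of_nonneg_right hl₀' hδ)
    · rw [hTlam s hs, hTlam t ht, sub_sub_sub_cancel_left, ← neg_sub, B8LambdaSpaceKLevel.covDerivFwd_neg', norm_neg]
      exact (hcL1 s t hs ht j hj p hp).trans (mul_le_mul_of_nonneg_right hl₁' hδ)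
  have hρ : 0 ≤ α₄ / 4 := by
    have h1 : 0 ≤ ρ := (norm_nonneg _).trans (hlρ 0)
    linarith
  obtain ⟨t, ⟨ht, hfix⟩, -⟩ := fixedPoint_closedBall T hρ (by norm_num : (0 : ℝ) ≤ 1 / 2) (by norm_num) hmaps hlip
  refine ⟨t, ht, ?_⟩
  have h := congrArg lamOf hfix
  rw [hTlam t ht] at h
  nth_rw 1 [← h]
  exact sub_add_cancel _ _

end Inverse

/-! ## §2 The injectivity half of the Neumann inversion (1.96): `D = −R(V D)` on the `Ω_j` forces `D = 0` -/

section Neumann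

variable {L k : ℕ} {η : ℝ} {Ω : ℕ → Set (Site d)} {Eb : ℕ → Set (Site d × Fin d)} {U₀ : Site d → Fin d → 𝔸ˣ}

/-- **A crude `|Δλ_t|₍₋₂₎`-bound on the ball**: for a point `t` of the space (1.102) and bond sets containing both bonds at every site of `Ω_j`,
`(Lʲη)²‖Δ^η_{U₀}λ_t(x)‖ ≤ 2dLᵏ‖t‖` on `Ω_j`, `j ≤ k` (each of the `2d` covariant differences entering `D^{η*}D^η` is `≤ ‖t‖(Lʲη)⁻¹`, unitary
transport; `Lʲ ≤ Lᵏ`).  Only finiteness is used downstream. [cite: Balaban1985RegularSpaces, (1.1) p.76, (1.102) p.93; Balaban1985BackgroundPropagators, (3.23) p.394] -/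
theorem bd2_covLap_lamOf (hL : 1 ≤ L) (hη : 0 < η) (hU₀ : ∀ x κ, U₀ x κ ∈ unitaryUnits 𝔸)
    (hEbΩ : ∀ j, j ≤ k → ∀ x ∈ Ω j, ∀ μ : Fin d, (x, μ) ∈ Eb j ∧ (x - e μ, μ) ∈ Eb j) (t : lamSubK η U₀ L k Eb) :
    Bd2 L η k Ω (covLap η U₀ (lamOf t)) (2 * d * (L : ℝ) ^ k * ‖t‖) := by
  intro j hj x hx
  have hLr : (1 : ℝ) ≤ L := by exact_mod_cast hL
  have hw : 0 < wt L η j := wt_pos hL hη j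
  -- each covariant difference at a bond of `Ω_j` is `≤ ‖t‖ (Lʲη)⁻¹`
  have hg : ∀ (y : Site d) (μ : Fin d), (y, μ) ∈ Eb j → wt L η j * ‖covDerivFwd η U₀ μ (lamOf t) y‖ ≤ ‖t‖ := fun y μ hy =>
    weight_mul_norm_covDerivFwd_le hη.le t hj hy
  -- one term `D*_μ D_μ λ` of the Laplacian
  have hterm : ∀ μ : Fin d, wt L η j ^ 2 * ‖covDeriv η U₀ μ (fun z => covDerivFwd η U₀ μ (lamOf t) z) x‖ ≤ 2 * (L : ℝ) ^ k * ‖t‖ := by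
    intro μ
    obtain ⟨h1, h2⟩ := hEbΩ j hj x hx μ
    have hu : ((U₀ (x - e μ) μ)⁻¹ : 𝔸ˣ) ∈ U1 𝔸 := (U1 𝔸).inv_mem (unitaryUnits_le_U1 (hU₀ _ μ))
    have hn : ‖covDeriv η U₀ μ (fun z => covDerivFwd η U₀ μ (lamOf t) z) x‖ ≤
        η⁻¹ * (‖covDerivFwd η U₀ μ (lamOf t) (x - e μ)‖ + ‖covDerivFwd η U₀ μ (lamOf t) x‖) := by
      rw [covDeriv, norm_smul, Real.norm_of_nonneg (inv_nonneg.2 hη.le)]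
      refine mul_le_mul_of_nonneg_left ((norm_sub_le _ _).trans (add_le_add (le_of_eq (norm_conjR hu _)) le_rfl)) (inv_nonneg.2 hη.le)
    have hLj : (L : ℝ) ^ j ≤ (L : ℝ) ^ k := pow_le_pow_right₀ hLr hj
    have hwdef : wt L η j = (L : ℝ) ^ j * η := rfl
    have hη0 : η ≠ 0 := hη.ne'
    calc wt L η j ^ 2 * ‖covDeriv η U₀ μ (fun z => covDerivFwd η U₀ μ (lamOf t) z) x‖
        ≤ wt L η j ^ 2 * (η⁻¹ * (‖covDerivFwd η U₀ μ (lamOf t) (x - e μ)‖ + ‖covDerivFwd η U₀ μ (lamOf t) x‖)) :=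
          mul_le_mul_of_nonneg_left hn (sq_nonneg _)
      _ = (L : ℝ) ^ j * (wt L η j * ‖covDerivFwd η U₀ μ (lamOf t) (x - e μ)‖ + wt L η j * ‖covDerivFwd η U₀ μ (lamOf t) x‖) := by
          rw [hwdef]; field_simp
      _ ≤ (L : ℝ) ^ k * (‖t‖ + ‖t‖) := by gcongr; exacts [hg _ μ h2, hg _ μ h1]
      _ = 2 * (L : ℝ) ^ k * ‖t‖ := by ring
  -- sum over the `d` directions
  have hsum : ‖covLap η U₀ (lamOf t) x‖ ≤ ∑ μ : Fin d, ‖covDeriv η U₀ μ (fun z => covDerivFwd η U₀ μ (lamOf t) z) x‖ := by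
    unfold covLap covDivB
    exact norm_sum_le _ _
  calc wt L η j ^ 2 * ‖covLap η U₀ (lamOf t) x‖
      ≤ wt L η j ^ 2 * ∑ μ : Fin d, ‖covDeriv η U₀ μ (fun z => covDerivFwd η U₀ μ (lamOf t) z) x‖ :=
        mul_le_mul_of_nonneg_left hsum (sq_nonneg _)
    _ = ∑ μ : Fin d, wt L η j ^ 2 * ‖covDeriv η U₀ μ (fun z => covDerivFwd η U₀ μ (lamOf t) z) x‖ := by rw [Finset.mul_sum]
    _ ≤ ∑ _μ : Fin d, 2 * (L : ℝ) ^ k * ‖t‖ := Finset.sum_le_sum fun μ _ => hterm μ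
    _ = 2 * d * (L : ℝ) ^ k * ‖t‖ := by rw [Finset.sum_const, Finset.card_univ, Fintype.card_fin, nsmul_eq_mul]; ring

omit [Nontrivial 𝔸] in
/-- **THE INJECTIVITY HALF OF (1.96)** («the operator in the square bracket in (1.94) is invertible», p. 92): if a site function `D` with
`|D|₍₋₂₎ ≤ m` satisfies `D = −R(V D)` on every `Ω_j`, `j ≤ k`, for a sitewise map `V` with `|Vf| ≤ c_V|f|` there ((1.98)V) and a letter `R`
with `|Rf|₍₋₂₎ ≤ B_R|f|₍₋₂₎` ((1.98)R), `c_VB_R ≤ ½`, then `|D|₍₋₂₎ ≤ 2⁻ⁿm` for every `n`, so `D = 0` on every `Ω_j`.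
[cite: Balaban1985RegularSpaces, (1.96), (1.98) p.92, (1.94) p.92] -/
theorem neumann_injective (hL : 1 ≤ L) (hη : 0 < η) {V R : (Site d → 𝔸) → (Site d → 𝔸)} {cV BR m : ℝ}
    (hVbd : ∀ f : Site d → 𝔸, ∀ j, j ≤ k → ∀ x ∈ Ω j, ‖V f x‖ ≤ cV * ‖f x‖)
    (hRbd : ∀ (f : Site d → 𝔸) (m : ℝ), 0 ≤ m → Bd2 L η k Ω f m → Bd2 L η k Ω (R f) (BR * m))
    (hcV : 0 ≤ cV) (hm : 0 ≤ m) (hθ : cV * BR ≤ 1 / 2)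
    {D : Site d → 𝔸} (hD : Bd2 L η k Ω D m) (heq : ∀ j, j ≤ k → ∀ x ∈ Ω j, D x = -R (V D) x) :
    ∀ j, j ≤ k → ∀ x ∈ Ω j, D x = 0 := by
  -- `|D|₍₋₂₎ ≤ 2⁻ⁿ m`
  have hiter : ∀ n : ℕ, Bd2 L η k Ω D ((1 / 2) ^ n * m) := by
    intro n
    induction n with
    | zero => simpa using hD
    | succ n ih =>
      have hmn : 0 ≤ (1 / 2 : ℝ) ^ n * m := by positivity
      have hV : Bd2 L η k Ω (V D) (cV * ((1 / 2) ^ n * m)) := by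
        intro j hj x hx
        calc wt L η j ^ 2 * ‖V D x‖ ≤ wt L η j ^ 2 * (cV * ‖D x‖) := mul_le_mul_of_nonneg_left (hVbd D j hj x hx) (sq_nonneg _)
          _ = cV * (wt L η j ^ 2 * ‖D x‖) := by ring
          _ ≤ cV * ((1 / 2) ^ n * m) := mul_le_mul_of_nonneg_left (ih j hj x hx) hcV
      have hRV := hRbd (V D) _ (by positivity) hV
      intro j hj x hx
      rw [heq j hj x hx, norm_neg]
      calc wt L η j ^ 2 * ‖R (V D) x‖ ≤ BR * (cV * ((1 / 2) ^ n * m)) := hRV j hj x hx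
        _ = (cV * BR) * ((1 / 2) ^ n * m) := by ring
        _ ≤ 1 / 2 * ((1 / 2) ^ n * m) := mul_le_mul_of_nonneg_right hθ hmn
        _ = (1 / 2) ^ (n + 1) * m := by ring
  intro j hj x hx
  have hw : 0 < wt L η j ^ 2 := pow_pos (wt_pos hL hη j) 2
  have hlim : Tendsto (fun n : ℕ => (1 / 2 : ℝ) ^ n * m) atTop (𝓝 (0 * m)) :=
    (tendsto_pow_atTop_nhds_zero_of_lt_one (by norm_num) (by norm_num)).mul_const m
  rw [zero_mul] at hlim
  have hle : wt L η j ^ 2 * ‖D x‖ ≤ 0 := ge_of_tendsto' hlim fun n => hiter n j hj x hx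
  have hn : ‖D x‖ ≤ 0 := by
    by_contra hpos
    have := mul_pos hw (not_le.1 hpos)
    linarith
  exact norm_le_zero_iff.1 hn

end Neumann

/-! ## §3 «R f = 0 ⟸ Δf = Q′*μ» with the LEFT-inverse law of C in range form -/

section Proj

variable {E F : Type*} [AddCommGroup E] [Module ℂ E] [AddCommGroup F] [Module ℂ F]

/-- **«R f = 0» from the multiplier form** for `R = I − G′Q′*CQ′G′` of [4] (3.25): if `Δf = Q′*μ`, then `f = G′Q′*(μ + aQ′f)` (left-inverse law
of `G′` for `Δ′_a = Δ + Q′*aQ′`) and `CQ′G′f = CQ′G′²Q′*(μ + aQ′f)`, whose `Q′*`-image is `Q′*(μ + aQ′f)` by the left-inverse law of `C` IN RANGE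
FORM `c_left' : Q′*C(Q′G′²Q′*φ) = Q′*φ` (what `(Q′G′²Q′*)⁻¹` satisfies when the letters are zero-extended off `𝔅_k`); hence `G′Q′*CQ′G′f = f`.
(`B8Eq138Multiplier.proj325_apply_eq_zero_iff_exists` is the same with the full-space `c_left`.)
[cite: Balaban1985BackgroundPropagators, (3.25) p.394; Balaban1985RegularSpaces, (1.38) p.82, (1.95) p.92] -/
theorem proj325_eq_zero_of_multiplier' (g Δ : E →ₗ[ℂ] E) (q : E →ₗ[ℂ] F) (qs : F →ₗ[ℂ] E) (Aw c : F →ₗ[ℂ] F)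
    (g_left : ∀ x, g (Δ x + qs (Aw (q x))) = x) (c_left' : ∀ φ, qs (c (q (g (g (qs φ))))) = qs φ)
    {f : E} {μ : F} (h : Δ f = qs μ) : f - g (qs (c (q (g f)))) = 0 := by
  have hf : f = g (qs (μ + Aw (q f))) := by
    have := g_left f
    rw [h, ← map_add] at this
    exact this.symm
  have h1 : qs (c (q (g f))) = qs (μ + Aw (q f)) := by
    conv_lhs => rw [hf]
    exact c_left' _
  rw [h1, ← hf, sub_self]

end Proj

/-! ## §4 The converse of JOIN-B: a small solution of (1.107) in the knit's currency is the gauge parameter of a fixed point of (1.100) -/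

section Converse

variable {L k : ℕ} {η β : ℝ} {Ω Λs : ℕ → Set (Site d)} {Eb : ℕ → Set (Site d × Fin d)} {U₀ : Site d → Fin d → 𝔸ˣ}
  {A : Site d → Fin d → 𝔸} {u₁ : Site d → 𝔸ˣ}

/-- **THE CONVERSE OF JOIN-B** («Of course (1.95) imply (1.100)», p. 93, with p. 94's last paragraph and (1.96)).  Setting: the `Ω 0 = univ`
sub-family; the letters `g Δ q qs Aw c` of [4] with the left-inverse law `g_left` of `G′`, the LEFT-inverse law of `C` in range form `c_left'`,
and the readings `hΔ`/`hqs`; the correction `H_c` of `λ′ = λ + H_cλ` with JOIN-B's size/modulus binders `hc0 hc1 hc2 hcL0 hcL1` and the inversion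
windows `l₀, l₁ ≤ ½`, `ρ + h₀, ρ + h₁ ≤ ¼α₄`; (1.98)R `hRbd` for `R = I − G′Q′*CQ′G′`; the datum `D*A`, `A`; JOIN-B's windows `ha₁' hb₁' hb₁ hθ`;
Sect. E's (1.114) in its converse printed use `h114q`; [3] Prop. 10's inputs `hdom`/`h167` for the inverse pair on the ball and (1.29) for `u₁⁻¹`.
CLAIM: every site function `λ′` with `‖λ′‖ ≤ ρ` everywhere and `(Lʲη)‖D^η_{U₀}λ′‖ ≤ ρ` on the `Eb j`, obeying THE MULTIPLIER CLAUSE OF `HFP`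
(`∃ μ, Δ↾Ω₀[D*A + Δλ′ + 𝔑(λ′)] = Q′ᵀμ` on `Ω₀`) and `Restr129 L k Λs U₀ (u₁·e^{iλ′})`, is `λ_t + H_cλ_t` for a point `t` of the ¼α₄-ball with
`λ_t = G′(Ψλ_t)`, `Ψ = PsiP5 … R (λ ↦ λ + H_cλ) (λ ↦ ΔH_cλ)` — the fixed-point equation of `B8Prop5ContractionKLevel.propFive_fixedPoint_kLevel`
literally.  Steps: `sectE_inverse_kLevel`; (1.29) ⇒ (1.79) for `((e^{iλ′})⁻¹, u₁⁻¹)` (`restr129_mul_iff_inv_mul`, `restr129_mul_iff_cond179`) ⇒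
`Q′λ_t = 0` (`h114q`); multiplier ⇒ `R N = 0` (`proj325_eq_zero_of_multiplier'`) with `N = W + Δλ_t + V(Δλ_t)` (`dstar_rhs_eq_W_add`); `RΔλ_t = Δλ_t`;
`Z + V(RZ) = W` (`zsol_eq`); so `Δλ_t + RZ = −RV(Δλ_t + RZ)`, whence `Δλ_t = R(−Z)` (`neumann_injective`) and `λ_t = G′R(−Z)` (`g_left`).
[cite: Balaban1985RegularSpaces, Prop. 5 (1.107)–(1.109) p.94, (1.93)–(1.100) pp.92–93, (1.113)–(1.114) p.95, (1.78)–(1.79) p.90, (1.38) p.82] -/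
theorem isFixedPoint_of_HFP (hL : 1 ≤ L) (hη : 0 < η) (hU₀ : ∀ x κ, U₀ x κ ∈ unitaryUnits 𝔸) (hΩ0 : Ω 0 = Set.univ)
    (hEbΩ : ∀ j, j ≤ k → ∀ x ∈ Ω j, ∀ μ : Fin d, (x, μ) ∈ Eb j ∧ (x - e μ, μ) ∈ Eb j)
    -- letters of [4]
    (g Δ : (Site d → 𝔸) →ₗ[ℂ] (Site d → 𝔸)) (q : (Site d → 𝔸) →ₗ[ℂ] (ℕ → Site d → 𝔸)) (qs : (ℕ → Site d → 𝔸) →ₗ[ℂ] (Site d → 𝔸))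
    (Aw c : (ℕ → Site d → 𝔸) →ₗ[ℂ] (ℕ → Site d → 𝔸))
    (g_left : ∀ x, g (Δ x + qs (Aw (q x))) = x) (c_left' : ∀ φ, qs (c (q (g (g (qs φ))))) = qs φ)
    (hΔ : ∀ (f : Site d → 𝔸), ∀ x ∈ Ω 0, Δ f x = covLap η U₀ ((Ω 0).indicator f) x)
    (hqs : ∀ (μ : ℕ → Site d → 𝔸), ∀ x ∈ Ω 0, qs μ x = QT L k Λs U₀ μ x)
    -- the Sect. E correction `H_c` (λ′ = λ + H_c λ) and the windows
    (Hc : (Site d → 𝔸) → (Site d → 𝔸))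
    {α₄ BR h₀ h₁ h₂ l₀ l₁ cA cDA ρ : ℝ}
    (hBR : 0 ≤ BR) (hh₀ : 0 ≤ h₀) (hh₂ : 0 ≤ h₂) (hcA : 0 ≤ cA) (hcA' : cA ≤ 1 / 13) (hcDA : 0 ≤ cDA)
    (ha₁' : α₄ / 4 + h₀ ≤ 1 / 24) (hb₁' : α₄ / 4 + h₁ ≤ 1 / 140) (hb₁ : 0 < α₄ / 4 + h₁) (hθ : 10 * (α₄ / 4 + h₀) * BR ≤ 1 / 2)
    (hl₀' : l₀ ≤ 1 / 2) (hl₁' : l₁ ≤ 1 / 2) (hρ₀ : ρ + h₀ ≤ α₄ / 4) (hρ₁ : ρ + h₁ ≤ α₄ / 4)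
    -- (1.98)R
    (hRbd : ∀ (f : Site d → 𝔸) (m : ℝ), 0 ≤ m → Bd2 L η k Ω f m → Bd2 L η k Ω (f - g (qs (c (q (g f))))) (BR * m))
    -- the binders of `H_c`
    (hc0 : ∀ s : lamSubK η U₀ L k Eb, ‖s‖ ≤ α₄ / 4 → ∀ x, ‖Hc (lamOf s) x‖ ≤ h₀)
    (hc1 : ∀ s : lamSubK η U₀ L k Eb, ‖s‖ ≤ α₄ / 4 → ∀ j, j ≤ k → ∀ p ∈ Eb j, wt L η j * ‖covDerivFwd η U₀ p.2 (Hc (lamOf s)) p.1‖ ≤ h₁)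
    (hc2 : ∀ s : lamSubK η U₀ L k Eb, ‖s‖ ≤ α₄ / 4 → Bd2 L η k Ω (covLap η U₀ (Hc (lamOf s))) h₂)
    (hcL0 : ∀ s t : lamSubK η U₀ L k Eb, ‖s‖ ≤ α₄ / 4 → ‖t‖ ≤ α₄ / 4 → ∀ x, ‖Hc (lamOf s) x - Hc (lamOf t) x‖ ≤ l₀ * ‖s - t‖)
    (hcL1 : ∀ s t : lamSubK η U₀ L k Eb, ‖s‖ ≤ α₄ / 4 → ‖t‖ ≤ α₄ / 4 → ∀ j, j ≤ k → ∀ p ∈ Eb j,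
      wt L η j * ‖covDerivFwd η U₀ p.2 (Hc (lamOf s) - Hc (lamOf t)) p.1‖ ≤ l₁ * ‖s - t‖)
    -- the datum
    (hDA : Bd2 L η k Ω (fun y => covDivB η U₀ A y) cDA)
    (hA : ∀ j, j ≤ k → ∀ x ∈ Ω j, ∀ μ : Fin d,
      wt L η j * ‖A x μ‖ ≤ cA ∧ wt L η j * ‖conjR (U₀ (x - e μ) μ)⁻¹ (A (x - e μ) μ)‖ ≤ cA)
    -- Sect. E (1.114) in its converse printed use; [3] Prop. 10 inputs for the inverse pair; (1.29) for u₁⁻¹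
    (h114q : ∀ s : lamSubK η U₀ L k Eb, ‖s‖ ≤ α₄ / 4 →
      Cond179 L k Λs U₀ (gaugeExp (lamOf s + Hc (lamOf s)))⁻¹ u₁⁻¹ → q (lamOf s) = 0)
    (hdom : ∀ s : lamSubK η U₀ L k Eb, ‖s‖ ≤ α₄ / 4 → ∀ j, j ≤ k → ∀ y ∈ Λs j,
      ‖util178 L U₀ (gaugeExp (lamOf s + Hc (lamOf s)))⁻¹ u₁⁻¹ j y - 1‖ < 1)
    (h167 : ∀ s : lamSubK η U₀ L k Eb, ‖s‖ ≤ α₄ / 4 → Cond167 L U₀ ((gaugeExp (lamOf s + Hc (lamOf s)))⁻¹ * u₁⁻¹) k β η)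
    (h129inv : Restr129 L k Λs U₀ u₁⁻¹) (hβ : 0 ≤ β) (hβs : β * (L : ℝ) ^ k * η < 1 / 2)
    -- the candidate solution
    {lam : Site d → 𝔸} (hlρ : ∀ x, ‖lam x‖ ≤ ρ)
    (hDρ : ∀ j, j ≤ k → ∀ p ∈ Eb j, wt L η j * ‖covDerivFwd η U₀ p.2 lam p.1‖ ≤ ρ)
    (hmult : ∃ μ : ℕ → Site d → 𝔸, ∀ x ∈ Ω 0,
      covLap η U₀ ((Ω 0).indicator fun y => covDivB η U₀ A y + covLap η U₀ lam y +
        ((conjR (gaugeExp lam y)⁻¹ (covDivB η U₀ A y) - covDivB η U₀ A y) +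
          (gAd (covLap η U₀ lam y) (lam y) - covLap η U₀ lam y) + ∑ μ, frakF3 η U₀ lam A y μ)) x = QT L k Λs U₀ μ x)
    (h129 : Restr129 L k Λs U₀ (u₁ * gaugeExp lam)) :
    ∃ t : lamSubK η U₀ L k Eb, ‖t‖ ≤ α₄ / 4 ∧ lamOf t + Hc (lamOf t) = lam ∧
      lamOf t = g (PsiP5 η U₀ A (fun y => covDivB η U₀ A y) (fun f => f - g (qs (c (q (g f)))))
        (fun l => l + Hc l) (fun l => covLap η U₀ (Hc l)) (lamOf t)) := by
  have huniv : ∀ x, x ∈ Ω 0 := fun x => by rw [hΩ0]; exact Set.mem_univ x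
  -- the letter R of (1.95)
  set R : (Site d → 𝔸) → (Site d → 𝔸) := fun f => f - g (qs (c (q (g f)))) with hRdef
  have hR : ∀ f, R f = f - g (qs (c (q (g f)))) := fun f => rfl
  have hRsub : ∀ f f' : Site d → 𝔸, R (f - f') = R f - R f' := proj325_sub (R := R) hR
  have hR0 : R 0 = 0 := by rw [hR]; simp
  have hRneg : ∀ f : Site d → 𝔸, R (-f) = -R f := fun f => by rw [← zero_sub, hRsub, hR0, zero_sub]
  have hRadd : ∀ f f' : Site d → 𝔸, R (f + f') = R f + R f' := fun f f' => by
    have h := hRsub (f + f') f'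
    rw [add_sub_cancel_right] at h
    rw [h, sub_add_cancel]
  -- Step 1: the inverse change of variables
  obtain ⟨t, ht, hgp⟩ := sectE_inverse_kLevel hη Hc hh₀ hl₀' hl₁' hρ₀ hρ₁ hc0 hc1 hcL0 hcL1 hlρ hDρ
  -- sizes of λ′ = λ_t + H_cλ_t
  have hρ0 : 0 ≤ ρ := (norm_nonneg _).trans (hlρ 0)
  have ha12 : ∀ x, ‖lam x‖ ≤ 1 / 12 := fun x => (hlρ x).trans (by linarith)
  have hlam_a : ∀ x, ‖lam x‖ ≤ α₄ / 4 + h₀ := fun x => by rw [← hgp]; exact gpar_size hc0 t ht x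
  have ha12' : α₄ / 4 + h₀ ≤ 1 / 12 := by linarith
  have hgrad : ∀ j, j ≤ k → ∀ x ∈ Ω j, ∀ μ : Fin d,
      wt L η j * ‖covDerivFwd η U₀ μ lam x‖ ≤ α₄ / 4 + h₁ ∧ wt L η j * ‖covDeriv η U₀ μ lam x‖ ≤ α₄ / 4 + h₁ := by
    intro j hj x hx μ
    rw [← hgp]
    exact gpar_grad hη hU₀ hEbΩ hc1 t ht hj hx μ
  -- the Neumann data at λ′
  have hVsub : ∀ f f' : Site d → 𝔸, ∀ j, j ≤ k → ∀ x ∈ Ω j, Vop lam f x - Vop lam f' x = Vop lam (f - f') x :=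
    fun f f' j _ x _ => Vop_sub f f' (ha12 x)
  have hVbd : ∀ f : Site d → 𝔸, ∀ j, j ≤ k → ∀ x ∈ Ω j, ‖Vop lam f x‖ ≤ 10 * (α₄ / 4 + h₀) * ‖f x‖ :=
    fun f j _ x _ => norm_Vop_le f (hlam_a x) ha12'
  have hcV : 0 ≤ 10 * (α₄ / 4 + h₀) := by linarith
  set mW := mWc d (α₄ / 4 + h₁) cA h₂ cDA with hmWdef
  have hmW : 0 ≤ mW := mWc_nonneg hb₁.le hcA hh₂ hcDA
  set W : Site d → 𝔸 := Wsrc η U₀ A (fun y => covDivB η U₀ A y) lam (covLap η U₀ (Hc (lamOf t))) with hWdef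
  have hW : Bd2 L η k Ω W mW := fun j hj x hx =>
    wt_sq_norm_Wsrc_le hL hη (by linarith : α₄ / 4 + h₁ ≤ 1 / 70) hcA (by linarith : cA ≤ 1 / 12) (ha12 x) (hgrad j hj x hx)
      (hA j hj x hx) (hc2 t ht j hj x hx) (hDA j hj x hx)
  set Z : Site d → 𝔸 := Zsol W (Vop lam) R with hZdef
  have hZeq : ∀ j, j ≤ k → ∀ x ∈ Ω j, Z x + Vop lam (R Z) x = W x :=
    fun j hj x hx => zsol_eq hL hη hVsub hVbd hRsub hRbd hW hcV hBR hmW hθ hj hx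
  have hZbd : Bd2 L η k Ω Z (2 * mW) := bd2_zsol hL hη hVsub hVbd hRsub hRbd hW hcV hBR hmW hθ
  -- Step 2: `Q′λ_t = 0` from (1.29) for u₁·e^{iλ′} via the inverse pair and (1.114)
  have hdom' := hdom t ht
  have h167' := h167 t ht
  rw [hgp] at hdom' h167'
  have h179 : Cond179 L k Λs U₀ (gaugeExp lam)⁻¹ u₁⁻¹ :=
    (restr129_mul_iff_cond179 h129inv hdom').1 ((restr129_mul_iff_inv_mul h167' hL hη.le hβ hβs).1 h129)
  have hq0 : q (lamOf t) = 0 := h114q t ht (by rw [hgp]; exact h179)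
  -- Step 3: `R N = 0` for the right-hand side `N` of the D*-identity, from the multiplier clause
  set N : Site d → 𝔸 := fun y => covDivB η U₀ A y + covLap η U₀ lam y +
    ((conjR (gaugeExp lam y)⁻¹ (covDivB η U₀ A y) - covDivB η U₀ A y) +
      (gAd (covLap η U₀ lam y) (lam y) - covLap η U₀ lam y) + ∑ μ, frakF3 η U₀ lam A y μ) with hNdef
  obtain ⟨μ, hμ⟩ := hmult
  have hΔN : Δ N = qs μ := funext fun x => by
    rw [hΔ N x (huniv x), hqs μ x (huniv x)]
    exact hμ x (huniv x)
  have hRN : R N = 0 := proj325_eq_zero_of_multiplier' g Δ q qs Aw c g_left c_left' hΔN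
  -- Step 4: `N = W + (Δλ_t + V Δλ_t)` (the D*-identity's right-hand side regrouped at λ′ = λ_t − (−H_cλ_t))
  set Y : Site d → 𝔸 := covLap η U₀ (lamOf t) with hYdef
  have hdef : lam = lamOf t - (-Hc (lamOf t)) := by rw [sub_neg_eq_add, hgp]
  have hNW : N = W + (Y + Vop lam Y) := funext fun y => by
    have h := dstar_rhs_eq_W_add (η := η) U₀ A hdef (ha12 y)
    rw [covLap_neg', gAd_neg _ (ha12 y), sub_neg_eq_add] at h
    exact h
  -- Step 5: `RΔλ_t = Δλ_t`, and the Neumann identity, give `Δλ_t = −RZ`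
  have hYΔ : Y = Δ (lamOf t) := funext fun x => by
    rw [hΔ _ x (huniv x), hΩ0, Set.indicator_univ]
  have hgY : g Y = lamOf t := by
    have h := g_left (lamOf t)
    rw [hq0, map_zero, map_zero, add_zero, ← hYΔ] at h
    exact h
  have hRY : R Y = Y := by
    rw [hR, hgY, hq0, map_zero, map_zero, map_zero, sub_zero]
  have hVadd : ∀ f f' : Site d → 𝔸, Vop lam (f + f') = Vop lam f + Vop lam f' := fun f f' => by
    funext x
    have h := Vop_sub (a := lam) (f + f') f' (ha12 x)
    rw [add_sub_cancel_right] at h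
    rw [Pi.add_apply, ← h, sub_add_cancel]
  have hWfun : W = Z + Vop lam (R Z) := funext fun x => by
    rw [Pi.add_apply]
    exact (hZeq 0 (Nat.zero_le _) x (huniv x)).symm
  set D : Site d → 𝔸 := Y + R Z with hDdef
  have hDeq : D = -R (Vop lam D) := by
    have h1 : R Z + R (Vop lam (R Z)) + (Y + R (Vop lam Y)) = 0 := by
      calc R Z + R (Vop lam (R Z)) + (Y + R (Vop lam Y)) = R N := by rw [hNW, hRadd, hRadd, hWfun, hRadd, hRY]
        _ = 0 := hRN
    have h2 : R (Vop lam D) = R (Vop lam Y) + R (Vop lam (R Z)) := by rw [hDdef, hVadd, hRadd]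
    have h3 : (Y + R Z) + (R (Vop lam Y) + R (Vop lam (R Z))) = 0 := by rw [← h1]; abel
    rw [h2]
    exact eq_neg_of_add_eq_zero_left h3
  have hDbd : Bd2 L η k Ω D (2 * d * (L : ℝ) ^ k * ‖t‖ + BR * (2 * mW)) :=
    (bd2_covLap_lamOf hL hη hU₀ hEbΩ t).add (hRbd Z (2 * mW) (by positivity) hZbd)
  have hD0 : ∀ j, j ≤ k → ∀ x ∈ Ω j, D x = 0 :=
    neumann_injective hL hη hVbd hRbd hcV (by positivity) hθ hDbd fun j _ x _ => congrFun hDeq x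
  have hYRZ : Y = -R Z := funext fun x => by
    have h : Y x + R Z x = 0 := hD0 0 (Nat.zero_le _) x (huniv x)
    rw [Pi.neg_apply]
    exact eq_neg_of_add_eq_zero_left h
  -- Step 6: the fixed-point equation (1.100): `λ_t = G′Δλ_t = G′R(−Z)`
  have hΔt : Δ (lamOf t) = R (fun x => -Z x) := by
    rw [← hYΔ, hYRZ, ← hRneg]
    rfl
  have hfix : lamOf t = g (R (fun x => -Z x)) := by
    have h := g_left (lamOf t)
    rw [hq0, map_zero, map_zero, add_zero, hΔt] at h
    exact h.symm
  refine ⟨t, ht, hgp, ?_⟩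
  simp only [PsiP5, hgp]
  exact hfix

/-! ## §5 Proposition 5's uniqueness clause (1.109) at `k` levels in the knit's currency -/

/-- **PROPOSITION 5, THE UNIQUENESS CLAUSE (1.109), AT `k` LEVELS ON THE CONCRETE `ℤᵈ × 𝔸` CARRIERS, IN THE KNIT'S CURRENCY** («Such a
configuration u′ is unique in the domain |λ|, |Dλ|₍₋₁₎ < c₃», p. 94).  Setting of `isFixedPoint_of_HFP` plus the contraction's own
hypotheses ((1.101) `hG`, the modulus binder `hcL2`, the smallness (1.103) `h103` and (1.106) `h106` at JOIN-B's constants) — i.e. JOIN-B/C's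
displayed letters, correction, datum and windows on the `Ω 0 = univ` sub-family, with the four extras `c_left'`, `h114q`, the inversion windows,
`hΩ0`.  CLAIM: two site functions `λ′₁, λ′₂`, each with `‖λ′ᵢ‖ ≤ ρ` everywhere and `(Lʲη)‖D^η_{U₀}λ′ᵢ‖ ≤ ρ` on the `Eb j`, each obeying the
multiplier clause of `HFP` and `Restr129 L k Λs U₀ (u₁·e^{iλ′ᵢ})`, ARE EQUAL: both are `λ_s + H_cλ_s` for THE fixed point `s` of
`propFive_fixedPoint_kLevel` (`isFixedPoint_of_HFP` + its `∃!`).  `ρ` = print's c₃ (any radius with `ρ + h₀, ρ + h₁ ≤ ¼α₄`).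
[cite: Balaban1985RegularSpaces, Prop. 5 (1.109) p.94, p.94 (after (1.106)), (1.100) p.93] -/
theorem hFP_unique_kLevel (hL : 1 ≤ L) (hη : 0 < η) (hU₀ : ∀ x κ, U₀ x κ ∈ unitaryUnits 𝔸) (hΩ0 : Ω 0 = Set.univ)
    (hEbΩ : ∀ j, j ≤ k → ∀ x ∈ Ω j, ∀ μ : Fin d, (x, μ) ∈ Eb j ∧ (x - e μ, μ) ∈ Eb j)
    -- letters of [4]
    (g Δ : (Site d → 𝔸) →ₗ[ℂ] (Site d → 𝔸)) (q : (Site d → 𝔸) →ₗ[ℂ] (ℕ → Site d → 𝔸)) (qs : (ℕ → Site d → 𝔸) →ₗ[ℂ] (Site d → 𝔸))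
    (Aw c : (ℕ → Site d → 𝔸) →ₗ[ℂ] (ℕ → Site d → 𝔸))
    (g_left : ∀ x, g (Δ x + qs (Aw (q x))) = x) (c_left' : ∀ φ, qs (c (q (g (g (qs φ))))) = qs φ)
    (hΔ : ∀ (f : Site d → 𝔸), ∀ x ∈ Ω 0, Δ f x = covLap η U₀ ((Ω 0).indicator f) x)
    (hqs : ∀ (μ : ℕ → Site d → 𝔸), ∀ x ∈ Ω 0, qs μ x = QT L k Λs U₀ μ x)
    -- the Sect. E correction `H_c` (λ′ = λ + H_c λ) and the windows
    (Hc : (Site d → 𝔸) → (Site d → 𝔸))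
    {α₄ BG BR h₀ h₁ h₂ l₀ l₁ l₂ cA cDA ρ : ℝ}
    (hα₄ : 0 ≤ α₄) (hBG : 0 ≤ BG) (hBR : 0 ≤ BR) (hh₀ : 0 ≤ h₀) (hh₂ : 0 ≤ h₂) (hl₀ : 0 ≤ l₀) (hl₁ : 0 ≤ l₁) (hl₂ : 0 ≤ l₂)
    (hcA : 0 ≤ cA) (hcA' : cA ≤ 1 / 13) (hcDA : 0 ≤ cDA)
    (ha₁' : α₄ / 4 + h₀ ≤ 1 / 24) (hb₁' : α₄ / 4 + h₁ ≤ 1 / 140) (hb₁ : 0 < α₄ / 4 + h₁) (hθ : 10 * (α₄ / 4 + h₀) * BR ≤ 1 / 2)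
    (hl₀' : l₀ ≤ 1 / 2) (hl₁' : l₁ ≤ 1 / 2) (hρ₀ : ρ + h₀ ≤ α₄ / 4) (hρ₁ : ρ + h₁ ≤ α₄ / 4)
    -- (1.101) for G′, (1.98)R
    (hG : ∀ (f : Site d → 𝔸) (m : ℝ), 0 ≤ m → Bd2 L η k Ω f m →
      (∀ x, ‖g f x‖ ≤ BG * m) ∧ ∀ j, j ≤ k → ∀ p ∈ Eb j, wt L η j * ‖covDerivFwd η U₀ p.2 (g f) p.1‖ ≤ BG * m)
    (hRbd : ∀ (f : Site d → 𝔸) (m : ℝ), 0 ≤ m → Bd2 L η k Ω f m → Bd2 L η k Ω (f - g (qs (c (q (g f))))) (BR * m))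
    -- the binders of `H_c`
    (hc0 : ∀ s : lamSubK η U₀ L k Eb, ‖s‖ ≤ α₄ / 4 → ∀ x, ‖Hc (lamOf s) x‖ ≤ h₀)
    (hc1 : ∀ s : lamSubK η U₀ L k Eb, ‖s‖ ≤ α₄ / 4 → ∀ j, j ≤ k → ∀ p ∈ Eb j, wt L η j * ‖covDerivFwd η U₀ p.2 (Hc (lamOf s)) p.1‖ ≤ h₁)
    (hc2 : ∀ s : lamSubK η U₀ L k Eb, ‖s‖ ≤ α₄ / 4 → Bd2 L η k Ω (covLap η U₀ (Hc (lamOf s))) h₂)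
    (hcL0 : ∀ s t : lamSubK η U₀ L k Eb, ‖s‖ ≤ α₄ / 4 → ‖t‖ ≤ α₄ / 4 → ∀ x, ‖Hc (lamOf s) x - Hc (lamOf t) x‖ ≤ l₀ * ‖s - t‖)
    (hcL1 : ∀ s t : lamSubK η U₀ L k Eb, ‖s‖ ≤ α₄ / 4 → ‖t‖ ≤ α₄ / 4 → ∀ j, j ≤ k → ∀ p ∈ Eb j,
      wt L η j * ‖covDerivFwd η U₀ p.2 (Hc (lamOf s) - Hc (lamOf t)) p.1‖ ≤ l₁ * ‖s - t‖)
    (hcL2 : ∀ s t : lamSubK η U₀ L k Eb, ‖s‖ ≤ α₄ / 4 → ‖t‖ ≤ α₄ / 4 →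
      Bd2 L η k Ω (covLap η U₀ (Hc (lamOf s)) - covLap η U₀ (Hc (lamOf t))) (l₂ * ‖s - t‖))
    -- the datum
    (hDA : Bd2 L η k Ω (fun y => covDivB η U₀ A y) cDA)
    (hA : ∀ j, j ≤ k → ∀ x ∈ Ω j, ∀ μ : Fin d,
      wt L η j * ‖A x μ‖ ≤ cA ∧ wt L η j * ‖conjR (U₀ (x - e μ) μ)⁻¹ (A (x - e μ) μ)‖ ≤ cA)
    -- smallness (1.103)/(1.106)
    (h103 : BG * Mc d BR (α₄ / 4 + h₁) cA h₂ cDA ≤ α₄ / 4)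
    (h106 : BG * Kc d BR (α₄ / 4 + h₁) cA h₂ cDA l₂ (1 + l₀) (1 + l₁) ≤ 1 / 2)
    -- Sect. E (1.114) in its converse printed use; [3] Prop. 10 inputs for the inverse pair; (1.29) for u₁⁻¹
    (h114q : ∀ s : lamSubK η U₀ L k Eb, ‖s‖ ≤ α₄ / 4 →
      Cond179 L k Λs U₀ (gaugeExp (lamOf s + Hc (lamOf s)))⁻¹ u₁⁻¹ → q (lamOf s) = 0)
    (hdom : ∀ s : lamSubK η U₀ L k Eb, ‖s‖ ≤ α₄ / 4 → ∀ j, j ≤ k → ∀ y ∈ Λs j,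
      ‖util178 L U₀ (gaugeExp (lamOf s + Hc (lamOf s)))⁻¹ u₁⁻¹ j y - 1‖ < 1)
    (h167 : ∀ s : lamSubK η U₀ L k Eb, ‖s‖ ≤ α₄ / 4 → Cond167 L U₀ ((gaugeExp (lamOf s + Hc (lamOf s)))⁻¹ * u₁⁻¹) k β η)
    (h129inv : Restr129 L k Λs U₀ u₁⁻¹) (hβ : 0 ≤ β) (hβs : β * (L : ℝ) ^ k * η < 1 / 2)
    -- the two solutions
    {lam₁ lam₂ : Site d → 𝔸}
    (hl₁ : ∀ x, ‖lam₁ x‖ ≤ ρ) (hD₁ : ∀ j, j ≤ k → ∀ p ∈ Eb j, wt L η j * ‖covDerivFwd η U₀ p.2 lam₁ p.1‖ ≤ ρ)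
    (hmult₁ : ∃ μ : ℕ → Site d → 𝔸, ∀ x ∈ Ω 0,
      covLap η U₀ ((Ω 0).indicator fun y => covDivB η U₀ A y + covLap η U₀ lam₁ y +
        ((conjR (gaugeExp lam₁ y)⁻¹ (covDivB η U₀ A y) - covDivB η U₀ A y) +
          (gAd (covLap η U₀ lam₁ y) (lam₁ y) - covLap η U₀ lam₁ y) + ∑ μ, frakF3 η U₀ lam₁ A y μ)) x = QT L k Λs U₀ μ x)
    (h129₁ : Restr129 L k Λs U₀ (u₁ * gaugeExp lam₁))
    (hl₂' : ∀ x, ‖lam₂ x‖ ≤ ρ) (hD₂ : ∀ j, j ≤ k → ∀ p ∈ Eb j, wt L η j * ‖covDerivFwd η U₀ p.2 lam₂ p.1‖ ≤ ρ)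
    (hmult₂ : ∃ μ : ℕ → Site d → 𝔸, ∀ x ∈ Ω 0,
      covLap η U₀ ((Ω 0).indicator fun y => covDivB η U₀ A y + covLap η U₀ lam₂ y +
        ((conjR (gaugeExp lam₂ y)⁻¹ (covDivB η U₀ A y) - covDivB η U₀ A y) +
          (gAd (covLap η U₀ lam₂ y) (lam₂ y) - covLap η U₀ lam₂ y) + ∑ μ, frakF3 η U₀ lam₂ A y μ)) x = QT L k Λs U₀ μ x)
    (h129₂ : Restr129 L k Λs U₀ (u₁ * gaugeExp lam₂)) :
    lam₁ = lam₂ := by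
  obtain ⟨t₁, ht₁, hgp₁, hfix₁⟩ := isFixedPoint_of_HFP hL hη hU₀ hΩ0 hEbΩ g Δ q qs Aw c g_left c_left' hΔ hqs Hc hBR hh₀ hh₂ hcA hcA'
    hcDA ha₁' hb₁' hb₁ hθ hl₀' hl₁' hρ₀ hρ₁ hRbd hc0 hc1 hc2 hcL0 hcL1 hDA hA h114q hdom h167 h129inv hβ hβs hl₁ hD₁ hmult₁ h129₁
  obtain ⟨t₂, ht₂, hgp₂, hfix₂⟩ := isFixedPoint_of_HFP hL hη hU₀ hΩ0 hEbΩ g Δ q qs Aw c g_left c_left' hΔ hqs Hc hBR hh₀ hh₂ hcA hcA'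
    hcDA ha₁' hb₁' hb₁ hθ hl₀' hl₁' hρ₀ hρ₁ hRbd hc0 hc1 hc2 hcL0 hcL1 hDA hA h114q hdom h167 h129inv hβ hβs hl₂' hD₂ hmult₂ h129₂
  -- the letter R and the displayed maps of the contraction
  set R : (Site d → 𝔸) → (Site d → 𝔸) := fun f => f - g (qs (c (q (g f)))) with hRdef
  have hR : ∀ f, R f = f - g (qs (c (q (g f)))) := fun f => rfl
  have hRsub : ∀ f f' : Site d → 𝔸, R (f - f') = R f - R f' := proj325_sub (R := R) hR
  set gpar : (Site d → 𝔸) → (Site d → 𝔸) := fun lam => lam + Hc lam with hgpar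
  set Eterm : (Site d → 𝔸) → (Site d → 𝔸) := fun lam => covLap η U₀ (Hc lam) with hEterm
  have hg0 : ∀ s : lamSubK η U₀ L k Eb, ‖s‖ ≤ α₄ / 4 → ∀ j, j ≤ k → ∀ x ∈ Ω j, ‖gpar (lamOf s) x‖ ≤ α₄ / 4 + h₀ :=
    fun s hs j _ x _ => gpar_size hc0 s hs x
  have hg1 : ∀ s : lamSubK η U₀ L k Eb, ‖s‖ ≤ α₄ / 4 → ∀ j, j ≤ k → ∀ x ∈ Ω j, ∀ μ : Fin d,
      wt L η j * ‖covDerivFwd η U₀ μ (gpar (lamOf s)) x‖ ≤ α₄ / 4 + h₁ ∧ wt L η j * ‖covDeriv η U₀ μ (gpar (lamOf s)) x‖ ≤ α₄ / 4 + h₁ :=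
    fun s hs j hj x hx μ => gpar_grad hη hU₀ hEbΩ hc1 s hs hj hx μ
  have hgL : ∀ s t : lamSubK η U₀ L k Eb, ‖s‖ ≤ α₄ / 4 → ‖t‖ ≤ α₄ / 4 → ∀ j, j ≤ k → ∀ x ∈ Ω j,
      ‖gpar (lamOf s) x - gpar (lamOf t) x‖ ≤ (1 + l₀) * ‖s - t‖ ∧ ∀ μ : Fin d,
        wt L η j * ‖covDerivFwd η U₀ μ (gpar (lamOf s) - gpar (lamOf t)) x‖ ≤ (1 + l₁) * ‖s - t‖ ∧
        wt L η j * ‖covDeriv η U₀ μ (gpar (lamOf s) - gpar (lamOf t)) x‖ ≤ (1 + l₁) * ‖s - t‖ :=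
    fun s t hs ht j hj x hx => gpar_lip hη hU₀ hEbΩ hcL0 hcL1 s t hs ht hj hx
  have hE0 : ∀ s : lamSubK η U₀ L k Eb, ‖s‖ ≤ α₄ / 4 → Bd2 L η k Ω (Eterm (lamOf s)) h₂ := fun s hs => hc2 s hs
  have hEL : ∀ s t : lamSubK η U₀ L k Eb, ‖s‖ ≤ α₄ / 4 → ‖t‖ ≤ α₄ / 4 →
      Bd2 L η k Ω (Eterm (lamOf s) - Eterm (lamOf t)) (l₂ * ‖s - t‖) := fun s t hs ht => hcL2 s t hs ht
  -- the ∃! of the contraction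
  obtain ⟨s, -, huniq⟩ := propFive_fixedPoint_kLevel (Ω := Ω) (Eb := Eb) (U₀ := U₀) (A := A) (DA := fun y => covDivB η U₀ A y) hL hη
    (⇑g) R gpar Eterm hα₄ hBG hBR (by positivity) ha₁' hb₁ hb₁' hcA hcA' hcDA hh₂ hl₂ (by positivity) (by positivity) hθ hG
    (fun f f' => map_sub g f f') hRsub hRbd hg0 hg1 hgL hE0 hEL hDA hA h103 h106
  have e₁ : t₁ = s := huniq t₁ ⟨ht₁, hfix₁⟩
  have e₂ : t₂ = s := huniq t₂ ⟨ht₂, hfix₂⟩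
  rw [← hgp₁, ← hgp₂, e₁, e₂]

end Converse

#print axioms isFixedPoint_of_HFP
#print axioms hFP_unique_kLevel


/-! ## §6 (v1.1) The same with (1.79) for the inverse pair as the input — route-agnostic (global or tower-local inversion) -/

section Converse179

variable {L k : ℕ} {η : ℝ} {Ω Λs : ℕ → Set (Site d)} {Eb : ℕ → Set (Site d × Fin d)} {U₀ : Site d → Fin d → 𝔸ˣ}
  {A : Site d → Fin d → 𝔸} {u₁ : Site d → 𝔸ˣ}

/-- **(v1.1) THE CONVERSE OF JOIN-B, ROUTE-AGNOSTIC** — `isFixedPoint_of_HFP` with its (1.29)-clause input REPLACED by print's (1.79) for the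
inverse pair, «`Q′(u₁⁻¹, (e^{iλ′})⁻¹) = 0` on `𝔅_k`» (`Cond179 L k Λs U₀ (gaugeExp lam)⁻¹ u₁⁻¹`), so that EITHER inversion route supplies it:
the global one (`B8Restr129Inversion.restr129_mul_iff_inv_mul` + `B8Eq178Averages.restr129_mul_iff_cond179`, as `isFixedPoint_of_HFP` does)
or `pub-ymgap-dag-n04-b`'s tower-local one (`B8Restr129InversionLocal`).  The [3] Prop. 10 inputs `hdom`/`h167`, (1.29) for `u₁⁻¹` and the
`β`-window thereby leave the binder list; everything else and the conclusion (the fixed-point equation of `propFive_fixedPoint_kLevel` for a `t`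
with `λ_t + H_cλ_t = λ′`) are verbatim. [cite: Balaban1985RegularSpaces, Prop. 5 (1.107)–(1.109) p.94, (1.93)–(1.100) pp.92–93, (1.79) p.90, (1.113)–(1.114) p.95] -/
theorem isFixedPoint_of_cond179 (hL : 1 ≤ L) (hη : 0 < η) (hU₀ : ∀ x κ, U₀ x κ ∈ unitaryUnits 𝔸) (hΩ0 : Ω 0 = Set.univ)
    (hEbΩ : ∀ j, j ≤ k → ∀ x ∈ Ω j, ∀ μ : Fin d, (x, μ) ∈ Eb j ∧ (x - e μ, μ) ∈ Eb j)
    -- letters of [4]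
    (g Δ : (Site d → 𝔸) →ₗ[ℂ] (Site d → 𝔸)) (q : (Site d → 𝔸) →ₗ[ℂ] (ℕ → Site d → 𝔸)) (qs : (ℕ → Site d → 𝔸) →ₗ[ℂ] (Site d → 𝔸))
    (Aw c : (ℕ → Site d → 𝔸) →ₗ[ℂ] (ℕ → Site d → 𝔸))
    (g_left : ∀ x, g (Δ x + qs (Aw (q x))) = x) (c_left' : ∀ φ, qs (c (q (g (g (qs φ))))) = qs φ)
    (hΔ : ∀ (f : Site d → 𝔸), ∀ x ∈ Ω 0, Δ f x = covLap η U₀ ((Ω 0).indicator f) x)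
    (hqs : ∀ (μ : ℕ → Site d → 𝔸), ∀ x ∈ Ω 0, qs μ x = QT L k Λs U₀ μ x)
    -- the Sect. E correction `H_c` (λ′ = λ + H_c λ) and the windows
    (Hc : (Site d → 𝔸) → (Site d → 𝔸))
    {α₄ BR h₀ h₁ h₂ l₀ l₁ cA cDA ρ : ℝ}
    (hBR : 0 ≤ BR) (hh₀ : 0 ≤ h₀) (hh₂ : 0 ≤ h₂) (hcA : 0 ≤ cA) (hcA' : cA ≤ 1 / 13) (hcDA : 0 ≤ cDA)
    (ha₁' : α₄ / 4 + h₀ ≤ 1 / 24) (hb₁' : α₄ / 4 + h₁ ≤ 1 / 140) (hb₁ : 0 < α₄ / 4 + h₁) (hθ : 10 * (α₄ / 4 + h₀) * BR ≤ 1 / 2)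
    (hl₀' : l₀ ≤ 1 / 2) (hl₁' : l₁ ≤ 1 / 2) (hρ₀ : ρ + h₀ ≤ α₄ / 4) (hρ₁ : ρ + h₁ ≤ α₄ / 4)
    -- (1.98)R
    (hRbd : ∀ (f : Site d → 𝔸) (m : ℝ), 0 ≤ m → Bd2 L η k Ω f m → Bd2 L η k Ω (f - g (qs (c (q (g f))))) (BR * m))
    -- the binders of `H_c`
    (hc0 : ∀ s : lamSubK η U₀ L k Eb, ‖s‖ ≤ α₄ / 4 → ∀ x, ‖Hc (lamOf s) x‖ ≤ h₀)
    (hc1 : ∀ s : lamSubK η U₀ L k Eb, ‖s‖ ≤ α₄ / 4 → ∀ j, j ≤ k → ∀ p ∈ Eb j, wt L η j * ‖covDerivFwd η U₀ p.2 (Hc (lamOf s)) p.1‖ ≤ h₁)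
    (hc2 : ∀ s : lamSubK η U₀ L k Eb, ‖s‖ ≤ α₄ / 4 → Bd2 L η k Ω (covLap η U₀ (Hc (lamOf s))) h₂)
    (hcL0 : ∀ s t : lamSubK η U₀ L k Eb, ‖s‖ ≤ α₄ / 4 → ‖t‖ ≤ α₄ / 4 → ∀ x, ‖Hc (lamOf s) x - Hc (lamOf t) x‖ ≤ l₀ * ‖s - t‖)
    (hcL1 : ∀ s t : lamSubK η U₀ L k Eb, ‖s‖ ≤ α₄ / 4 → ‖t‖ ≤ α₄ / 4 → ∀ j, j ≤ k → ∀ p ∈ Eb j,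
      wt L η j * ‖covDerivFwd η U₀ p.2 (Hc (lamOf s) - Hc (lamOf t)) p.1‖ ≤ l₁ * ‖s - t‖)
    -- the datum
    (hDA : Bd2 L η k Ω (fun y => covDivB η U₀ A y) cDA)
    (hA : ∀ j, j ≤ k → ∀ x ∈ Ω j, ∀ μ : Fin d,
      wt L η j * ‖A x μ‖ ≤ cA ∧ wt L η j * ‖conjR (U₀ (x - e μ) μ)⁻¹ (A (x - e μ) μ)‖ ≤ cA)
    -- Sect. E (1.114) in its converse printed use
    (h114q : ∀ s : lamSubK η U₀ L k Eb, ‖s‖ ≤ α₄ / 4 →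
      Cond179 L k Λs U₀ (gaugeExp (lamOf s + Hc (lamOf s)))⁻¹ u₁⁻¹ → q (lamOf s) = 0)
    -- the candidate solution
    {lam : Site d → 𝔸} (hlρ : ∀ x, ‖lam x‖ ≤ ρ)
    (hDρ : ∀ j, j ≤ k → ∀ p ∈ Eb j, wt L η j * ‖covDerivFwd η U₀ p.2 lam p.1‖ ≤ ρ)
    (hmult : ∃ μ : ℕ → Site d → 𝔸, ∀ x ∈ Ω 0,
      covLap η U₀ ((Ω 0).indicator fun y => covDivB η U₀ A y + covLap η U₀ lam y +
        ((conjR (gaugeExp lam y)⁻¹ (covDivB η U₀ A y) - covDivB η U₀ A y) +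
          (gAd (covLap η U₀ lam y) (lam y) - covLap η U₀ lam y) + ∑ μ, frakF3 η U₀ lam A y μ)) x = QT L k Λs U₀ μ x)
    (h179 : Cond179 L k Λs U₀ (gaugeExp lam)⁻¹ u₁⁻¹) :
    ∃ t : lamSubK η U₀ L k Eb, ‖t‖ ≤ α₄ / 4 ∧ lamOf t + Hc (lamOf t) = lam ∧
      lamOf t = g (PsiP5 η U₀ A (fun y => covDivB η U₀ A y) (fun f => f - g (qs (c (q (g f)))))
        (fun l => l + Hc l) (fun l => covLap η U₀ (Hc l)) (lamOf t)) := by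
  have huniv : ∀ x, x ∈ Ω 0 := fun x => by rw [hΩ0]; exact Set.mem_univ x
  -- the letter R of (1.95)
  set R : (Site d → 𝔸) → (Site d → 𝔸) := fun f => f - g (qs (c (q (g f)))) with hRdef
  have hR : ∀ f, R f = f - g (qs (c (q (g f)))) := fun f => rfl
  have hRsub : ∀ f f' : Site d → 𝔸, R (f - f') = R f - R f' := proj325_sub (R := R) hR
  have hR0 : R 0 = 0 := by rw [hR]; simp
  have hRneg : ∀ f : Site d → 𝔸, R (-f) = -R f := fun f => by rw [← zero_sub, hRsub, hR0, zero_sub]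
  have hRadd : ∀ f f' : Site d → 𝔸, R (f + f') = R f + R f' := fun f f' => by
    have h := hRsub (f + f') f'
    rw [add_sub_cancel_right] at h
    rw [h, sub_add_cancel]
  -- Step 1: the inverse change of variables
  obtain ⟨t, ht, hgp⟩ := sectE_inverse_kLevel hη Hc hh₀ hl₀' hl₁' hρ₀ hρ₁ hc0 hc1 hcL0 hcL1 hlρ hDρ
  -- sizes of λ′ = λ_t + H_cλ_t
  have hρ0 : 0 ≤ ρ := (norm_nonneg _).trans (hlρ 0)
  have ha12 : ∀ x, ‖lam x‖ ≤ 1 / 12 := fun x => (hlρ x).trans (by linarith)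
  have hlam_a : ∀ x, ‖lam x‖ ≤ α₄ / 4 + h₀ := fun x => by rw [← hgp]; exact gpar_size hc0 t ht x
  have ha12' : α₄ / 4 + h₀ ≤ 1 / 12 := by linarith
  have hgrad : ∀ j, j ≤ k → ∀ x ∈ Ω j, ∀ μ : Fin d,
      wt L η j * ‖covDerivFwd η U₀ μ lam x‖ ≤ α₄ / 4 + h₁ ∧ wt L η j * ‖covDeriv η U₀ μ lam x‖ ≤ α₄ / 4 + h₁ := by
    intro j hj x hx μ
    rw [← hgp]
    exact gpar_grad hη hU₀ hEbΩ hc1 t ht hj hx μ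
  -- the Neumann data at λ′
  have hVsub : ∀ f f' : Site d → 𝔸, ∀ j, j ≤ k → ∀ x ∈ Ω j, Vop lam f x - Vop lam f' x = Vop lam (f - f') x :=
    fun f f' j _ x _ => Vop_sub f f' (ha12 x)
  have hVbd : ∀ f : Site d → 𝔸, ∀ j, j ≤ k → ∀ x ∈ Ω j, ‖Vop lam f x‖ ≤ 10 * (α₄ / 4 + h₀) * ‖f x‖ :=
    fun f j _ x _ => norm_Vop_le f (hlam_a x) ha12'
  have hcV : 0 ≤ 10 * (α₄ / 4 + h₀) := by linarith
  set mW := mWc d (α₄ / 4 + h₁) cA h₂ cDA with hmWdef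
  have hmW : 0 ≤ mW := mWc_nonneg hb₁.le hcA hh₂ hcDA
  set W : Site d → 𝔸 := Wsrc η U₀ A (fun y => covDivB η U₀ A y) lam (covLap η U₀ (Hc (lamOf t))) with hWdef
  have hW : Bd2 L η k Ω W mW := fun j hj x hx =>
    wt_sq_norm_Wsrc_le hL hη (by linarith : α₄ / 4 + h₁ ≤ 1 / 70) hcA (by linarith : cA ≤ 1 / 12) (ha12 x) (hgrad j hj x hx)
      (hA j hj x hx) (hc2 t ht j hj x hx) (hDA j hj x hx)
  set Z : Site d → 𝔸 := Zsol W (Vop lam) R with hZdef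
  have hZeq : ∀ j, j ≤ k → ∀ x ∈ Ω j, Z x + Vop lam (R Z) x = W x :=
    fun j hj x hx => zsol_eq hL hη hVsub hVbd hRsub hRbd hW hcV hBR hmW hθ hj hx
  have hZbd : Bd2 L η k Ω Z (2 * mW) := bd2_zsol hL hη hVsub hVbd hRsub hRbd hW hcV hBR hmW hθ
  -- Step 2: `Q′λ_t = 0` from (1.79) for the inverse pair and (1.114)
  have hq0 : q (lamOf t) = 0 := h114q t ht (by rw [hgp]; exact h179)
  -- Step 3: `R N = 0` for the right-hand side `N` of the D*-identity, from the multiplier clause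
  set N : Site d → 𝔸 := fun y => covDivB η U₀ A y + covLap η U₀ lam y +
    ((conjR (gaugeExp lam y)⁻¹ (covDivB η U₀ A y) - covDivB η U₀ A y) +
      (gAd (covLap η U₀ lam y) (lam y) - covLap η U₀ lam y) + ∑ μ, frakF3 η U₀ lam A y μ) with hNdef
  obtain ⟨μ, hμ⟩ := hmult
  have hΔN : Δ N = qs μ := funext fun x => by
    rw [hΔ N x (huniv x), hqs μ x (huniv x)]
    exact hμ x (huniv x)
  have hRN : R N = 0 := proj325_eq_zero_of_multiplier' g Δ q qs Aw c g_left c_left' hΔN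
  -- Step 4: `N = W + (Δλ_t + V Δλ_t)` (the D*-identity's right-hand side regrouped at λ′ = λ_t − (−H_cλ_t))
  set Y : Site d → 𝔸 := covLap η U₀ (lamOf t) with hYdef
  have hdef : lam = lamOf t - (-Hc (lamOf t)) := by rw [sub_neg_eq_add, hgp]
  have hNW : N = W + (Y + Vop lam Y) := funext fun y => by
    have h := dstar_rhs_eq_W_add (η := η) U₀ A hdef (ha12 y)
    rw [covLap_neg', gAd_neg _ (ha12 y), sub_neg_eq_add] at h
    exact h
  -- Step 5: `RΔλ_t = Δλ_t`, and the Neumann identity, give `Δλ_t = −RZ`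
  have hYΔ : Y = Δ (lamOf t) := funext fun x => by
    rw [hΔ _ x (huniv x), hΩ0, Set.indicator_univ]
  have hgY : g Y = lamOf t := by
    have h := g_left (lamOf t)
    rw [hq0, map_zero, map_zero, add_zero, ← hYΔ] at h
    exact h
  have hRY : R Y = Y := by
    rw [hR, hgY, hq0, map_zero, map_zero, map_zero, sub_zero]
  have hVadd : ∀ f f' : Site d → 𝔸, Vop lam (f + f') = Vop lam f + Vop lam f' := fun f f' => by
    funext x
    have h := Vop_sub (a := lam) (f + f') f' (ha12 x)
    rw [add_sub_cancel_right] at h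
    rw [Pi.add_apply, ← h, sub_add_cancel]
  have hWfun : W = Z + Vop lam (R Z) := funext fun x => by
    rw [Pi.add_apply]
    exact (hZeq 0 (Nat.zero_le _) x (huniv x)).symm
  set D : Site d → 𝔸 := Y + R Z with hDdef
  have hDeq : D = -R (Vop lam D) := by
    have h1 : R Z + R (Vop lam (R Z)) + (Y + R (Vop lam Y)) = 0 := by
      calc R Z + R (Vop lam (R Z)) + (Y + R (Vop lam Y)) = R N := by rw [hNW, hRadd, hRadd, hWfun, hRadd, hRY]
        _ = 0 := hRN
    have h2 : R (Vop lam D) = R (Vop lam Y) + R (Vop lam (R Z)) := by rw [hDdef, hVadd, hRadd]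
    have h3 : (Y + R Z) + (R (Vop lam Y) + R (Vop lam (R Z))) = 0 := by rw [← h1]; abel
    rw [h2]
    exact eq_neg_of_add_eq_zero_left h3
  have hDbd : Bd2 L η k Ω D (2 * d * (L : ℝ) ^ k * ‖t‖ + BR * (2 * mW)) :=
    (bd2_covLap_lamOf hL hη hU₀ hEbΩ t).add (hRbd Z (2 * mW) (by positivity) hZbd)
  have hD0 : ∀ j, j ≤ k → ∀ x ∈ Ω j, D x = 0 :=
    neumann_injective hL hη hVbd hRbd hcV (by positivity) hθ hDbd fun j _ x _ => congrFun hDeq x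
  have hYRZ : Y = -R Z := funext fun x => by
    have h : Y x + R Z x = 0 := hD0 0 (Nat.zero_le _) x (huniv x)
    rw [Pi.neg_apply]
    exact eq_neg_of_add_eq_zero_left h
  -- Step 6: the fixed-point equation (1.100): `λ_t = G′Δλ_t = G′R(−Z)`
  have hΔt : Δ (lamOf t) = R (fun x => -Z x) := by
    rw [← hYΔ, hYRZ, ← hRneg]
    rfl
  have hfix : lamOf t = g (R (fun x => -Z x)) := by
    have h := g_left (lamOf t)
    rw [hq0, map_zero, map_zero, add_zero, hΔt] at h
    exact h.symm
  refine ⟨t, ht, hgp, ?_⟩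
  simp only [PsiP5, hgp]
  exact hfix


/-- **(v1.1) PROPOSITION 5, THE UNIQUENESS CLAUSE (1.109), AT `k` LEVELS, ROUTE-AGNOSTIC** — `hFP_unique_kLevel` with each solution's (1.29)-clause
replaced by (1.79) for its inverse pair (`Cond179 L k Λs U₀ (gaugeExp lamᵢ)⁻¹ u₁⁻¹`), the [3]-inputs `hdom`/`h167`/(1.29) for `u₁⁻¹`/`β`-window
dropped.  Setting of `isFixedPoint_of_cond179` plus the contraction's own
hypotheses ((1.101) `hG`, the modulus binder `hcL2`, the smallness (1.103) `h103` and (1.106) `h106` at JOIN-B's constants) — i.e. JOIN-B/C's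
displayed letters, correction, datum and windows on the `Ω 0 = univ` sub-family, with the four extras `c_left'`, `h114q`, the inversion windows,
`hΩ0`.  CLAIM: two site functions `λ′₁, λ′₂`, each with `‖λ′ᵢ‖ ≤ ρ` everywhere and `(Lʲη)‖D^η_{U₀}λ′ᵢ‖ ≤ ρ` on the `Eb j`, each obeying the
multiplier clause of `HFP` and `Restr129 L k Λs U₀ (u₁·e^{iλ′ᵢ})`, ARE EQUAL: both are `λ_s + H_cλ_s` for THE fixed point `s` of
`propFive_fixedPoint_kLevel` (`isFixedPoint_of_HFP` + its `∃!`).  `ρ` = print's c₃ (any radius with `ρ + h₀, ρ + h₁ ≤ ¼α₄`).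
[cite: Balaban1985RegularSpaces, Prop. 5 (1.109) p.94, p.94 (after (1.106)), (1.100) p.93] -/
theorem hFP_unique_of_cond179 (hL : 1 ≤ L) (hη : 0 < η) (hU₀ : ∀ x κ, U₀ x κ ∈ unitaryUnits 𝔸) (hΩ0 : Ω 0 = Set.univ)
    (hEbΩ : ∀ j, j ≤ k → ∀ x ∈ Ω j, ∀ μ : Fin d, (x, μ) ∈ Eb j ∧ (x - e μ, μ) ∈ Eb j)
    -- letters of [4]
    (g Δ : (Site d → 𝔸) →ₗ[ℂ] (Site d → 𝔸)) (q : (Site d → 𝔸) →ₗ[ℂ] (ℕ → Site d → 𝔸)) (qs : (ℕ → Site d → 𝔸) →ₗ[ℂ] (Site d → 𝔸))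
    (Aw c : (ℕ → Site d → 𝔸) →ₗ[ℂ] (ℕ → Site d → 𝔸))
    (g_left : ∀ x, g (Δ x + qs (Aw (q x))) = x) (c_left' : ∀ φ, qs (c (q (g (g (qs φ))))) = qs φ)
    (hΔ : ∀ (f : Site d → 𝔸), ∀ x ∈ Ω 0, Δ f x = covLap η U₀ ((Ω 0).indicator f) x)
    (hqs : ∀ (μ : ℕ → Site d → 𝔸), ∀ x ∈ Ω 0, qs μ x = QT L k Λs U₀ μ x)
    -- the Sect. E correction `H_c` (λ′ = λ + H_c λ) and the windows
    (Hc : (Site d → 𝔸) → (Site d → 𝔸))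
    {α₄ BG BR h₀ h₁ h₂ l₀ l₁ l₂ cA cDA ρ : ℝ}
    (hα₄ : 0 ≤ α₄) (hBG : 0 ≤ BG) (hBR : 0 ≤ BR) (hh₀ : 0 ≤ h₀) (hh₂ : 0 ≤ h₂) (hl₀ : 0 ≤ l₀) (hl₁ : 0 ≤ l₁) (hl₂ : 0 ≤ l₂)
    (hcA : 0 ≤ cA) (hcA' : cA ≤ 1 / 13) (hcDA : 0 ≤ cDA)
    (ha₁' : α₄ / 4 + h₀ ≤ 1 / 24) (hb₁' : α₄ / 4 + h₁ ≤ 1 / 140) (hb₁ : 0 < α₄ / 4 + h₁) (hθ : 10 * (α₄ / 4 + h₀) * BR ≤ 1 / 2)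
    (hl₀' : l₀ ≤ 1 / 2) (hl₁' : l₁ ≤ 1 / 2) (hρ₀ : ρ + h₀ ≤ α₄ / 4) (hρ₁ : ρ + h₁ ≤ α₄ / 4)
    -- (1.101) for G′, (1.98)R
    (hG : ∀ (f : Site d → 𝔸) (m : ℝ), 0 ≤ m → Bd2 L η k Ω f m →
      (∀ x, ‖g f x‖ ≤ BG * m) ∧ ∀ j, j ≤ k → ∀ p ∈ Eb j, wt L η j * ‖covDerivFwd η U₀ p.2 (g f) p.1‖ ≤ BG * m)
    (hRbd : ∀ (f : Site d → 𝔸) (m : ℝ), 0 ≤ m → Bd2 L η k Ω f m → Bd2 L η k Ω (f - g (qs (c (q (g f))))) (BR * m))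
    -- the binders of `H_c`
    (hc0 : ∀ s : lamSubK η U₀ L k Eb, ‖s‖ ≤ α₄ / 4 → ∀ x, ‖Hc (lamOf s) x‖ ≤ h₀)
    (hc1 : ∀ s : lamSubK η U₀ L k Eb, ‖s‖ ≤ α₄ / 4 → ∀ j, j ≤ k → ∀ p ∈ Eb j, wt L η j * ‖covDerivFwd η U₀ p.2 (Hc (lamOf s)) p.1‖ ≤ h₁)
    (hc2 : ∀ s : lamSubK η U₀ L k Eb, ‖s‖ ≤ α₄ / 4 → Bd2 L η k Ω (covLap η U₀ (Hc (lamOf s))) h₂)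
    (hcL0 : ∀ s t : lamSubK η U₀ L k Eb, ‖s‖ ≤ α₄ / 4 → ‖t‖ ≤ α₄ / 4 → ∀ x, ‖Hc (lamOf s) x - Hc (lamOf t) x‖ ≤ l₀ * ‖s - t‖)
    (hcL1 : ∀ s t : lamSubK η U₀ L k Eb, ‖s‖ ≤ α₄ / 4 → ‖t‖ ≤ α₄ / 4 → ∀ j, j ≤ k → ∀ p ∈ Eb j,
      wt L η j * ‖covDerivFwd η U₀ p.2 (Hc (lamOf s) - Hc (lamOf t)) p.1‖ ≤ l₁ * ‖s - t‖)
    (hcL2 : ∀ s t : lamSubK η U₀ L k Eb, ‖s‖ ≤ α₄ / 4 → ‖t‖ ≤ α₄ / 4 →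
      Bd2 L η k Ω (covLap η U₀ (Hc (lamOf s)) - covLap η U₀ (Hc (lamOf t))) (l₂ * ‖s - t‖))
    -- the datum
    (hDA : Bd2 L η k Ω (fun y => covDivB η U₀ A y) cDA)
    (hA : ∀ j, j ≤ k → ∀ x ∈ Ω j, ∀ μ : Fin d,
      wt L η j * ‖A x μ‖ ≤ cA ∧ wt L η j * ‖conjR (U₀ (x - e μ) μ)⁻¹ (A (x - e μ) μ)‖ ≤ cA)
    -- smallness (1.103)/(1.106)
    (h103 : BG * Mc d BR (α₄ / 4 + h₁) cA h₂ cDA ≤ α₄ / 4)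
    (h106 : BG * Kc d BR (α₄ / 4 + h₁) cA h₂ cDA l₂ (1 + l₀) (1 + l₁) ≤ 1 / 2)
    -- Sect. E (1.114) in its converse printed use
    (h114q : ∀ s : lamSubK η U₀ L k Eb, ‖s‖ ≤ α₄ / 4 →
      Cond179 L k Λs U₀ (gaugeExp (lamOf s + Hc (lamOf s)))⁻¹ u₁⁻¹ → q (lamOf s) = 0)
    -- the two solutions
    {lam₁ lam₂ : Site d → 𝔸}
    (hl₁ : ∀ x, ‖lam₁ x‖ ≤ ρ) (hD₁ : ∀ j, j ≤ k → ∀ p ∈ Eb j, wt L η j * ‖covDerivFwd η U₀ p.2 lam₁ p.1‖ ≤ ρ)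
    (hmult₁ : ∃ μ : ℕ → Site d → 𝔸, ∀ x ∈ Ω 0,
      covLap η U₀ ((Ω 0).indicator fun y => covDivB η U₀ A y + covLap η U₀ lam₁ y +
        ((conjR (gaugeExp lam₁ y)⁻¹ (covDivB η U₀ A y) - covDivB η U₀ A y) +
          (gAd (covLap η U₀ lam₁ y) (lam₁ y) - covLap η U₀ lam₁ y) + ∑ μ, frakF3 η U₀ lam₁ A y μ)) x = QT L k Λs U₀ μ x)
    (h179₁ : Cond179 L k Λs U₀ (gaugeExp lam₁)⁻¹ u₁⁻¹)
    (hl₂' : ∀ x, ‖lam₂ x‖ ≤ ρ) (hD₂ : ∀ j, j ≤ k → ∀ p ∈ Eb j, wt L η j * ‖covDerivFwd η U₀ p.2 lam₂ p.1‖ ≤ ρ)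
    (hmult₂ : ∃ μ : ℕ → Site d → 𝔸, ∀ x ∈ Ω 0,
      covLap η U₀ ((Ω 0).indicator fun y => covDivB η U₀ A y + covLap η U₀ lam₂ y +
        ((conjR (gaugeExp lam₂ y)⁻¹ (covDivB η U₀ A y) - covDivB η U₀ A y) +
          (gAd (covLap η U₀ lam₂ y) (lam₂ y) - covLap η U₀ lam₂ y) + ∑ μ, frakF3 η U₀ lam₂ A y μ)) x = QT L k Λs U₀ μ x)
    (h179₂ : Cond179 L k Λs U₀ (gaugeExp lam₂)⁻¹ u₁⁻¹) :
    lam₁ = lam₂ := by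
  obtain ⟨t₁, ht₁, hgp₁, hfix₁⟩ := isFixedPoint_of_cond179 hL hη hU₀ hΩ0 hEbΩ g Δ q qs Aw c g_left c_left' hΔ hqs Hc hBR hh₀ hh₂ hcA
    hcA' hcDA ha₁' hb₁' hb₁ hθ hl₀' hl₁' hρ₀ hρ₁ hRbd hc0 hc1 hc2 hcL0 hcL1 hDA hA h114q hl₁ hD₁ hmult₁ h179₁
  obtain ⟨t₂, ht₂, hgp₂, hfix₂⟩ := isFixedPoint_of_cond179 hL hη hU₀ hΩ0 hEbΩ g Δ q qs Aw c g_left c_left' hΔ hqs Hc hBR hh₀ hh₂ hcA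
    hcA' hcDA ha₁' hb₁' hb₁ hθ hl₀' hl₁' hρ₀ hρ₁ hRbd hc0 hc1 hc2 hcL0 hcL1 hDA hA h114q hl₂' hD₂ hmult₂ h179₂
  -- the letter R and the displayed maps of the contraction
  set R : (Site d → 𝔸) → (Site d → 𝔸) := fun f => f - g (qs (c (q (g f)))) with hRdef
  have hR : ∀ f, R f = f - g (qs (c (q (g f)))) := fun f => rfl
  have hRsub : ∀ f f' : Site d → 𝔸, R (f - f') = R f - R f' := proj325_sub (R := R) hR
  set gpar : (Site d → 𝔸) → (Site d → 𝔸) := fun lam => lam + Hc lam with hgpar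
  set Eterm : (Site d → 𝔸) → (Site d → 𝔸) := fun lam => covLap η U₀ (Hc lam) with hEterm
  have hg0 : ∀ s : lamSubK η U₀ L k Eb, ‖s‖ ≤ α₄ / 4 → ∀ j, j ≤ k → ∀ x ∈ Ω j, ‖gpar (lamOf s) x‖ ≤ α₄ / 4 + h₀ :=
    fun s hs j _ x _ => gpar_size hc0 s hs x
  have hg1 : ∀ s : lamSubK η U₀ L k Eb, ‖s‖ ≤ α₄ / 4 → ∀ j, j ≤ k → ∀ x ∈ Ω j, ∀ μ : Fin d,
      wt L η j * ‖covDerivFwd η U₀ μ (gpar (lamOf s)) x‖ ≤ α₄ / 4 + h₁ ∧ wt L η j * ‖covDeriv η U₀ μ (gpar (lamOf s)) x‖ ≤ α₄ / 4 + h₁ :=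
    fun s hs j hj x hx μ => gpar_grad hη hU₀ hEbΩ hc1 s hs hj hx μ
  have hgL : ∀ s t : lamSubK η U₀ L k Eb, ‖s‖ ≤ α₄ / 4 → ‖t‖ ≤ α₄ / 4 → ∀ j, j ≤ k → ∀ x ∈ Ω j,
      ‖gpar (lamOf s) x - gpar (lamOf t) x‖ ≤ (1 + l₀) * ‖s - t‖ ∧ ∀ μ : Fin d,
        wt L η j * ‖covDerivFwd η U₀ μ (gpar (lamOf s) - gpar (lamOf t)) x‖ ≤ (1 + l₁) * ‖s - t‖ ∧
        wt L η j * ‖covDeriv η U₀ μ (gpar (lamOf s) - gpar (lamOf t)) x‖ ≤ (1 + l₁) * ‖s - t‖ :=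
    fun s t hs ht j hj x hx => gpar_lip hη hU₀ hEbΩ hcL0 hcL1 s t hs ht hj hx
  have hE0 : ∀ s : lamSubK η U₀ L k Eb, ‖s‖ ≤ α₄ / 4 → Bd2 L η k Ω (Eterm (lamOf s)) h₂ := fun s hs => hc2 s hs
  have hEL : ∀ s t : lamSubK η U₀ L k Eb, ‖s‖ ≤ α₄ / 4 → ‖t‖ ≤ α₄ / 4 →
      Bd2 L η k Ω (Eterm (lamOf s) - Eterm (lamOf t)) (l₂ * ‖s - t‖) := fun s t hs ht => hcL2 s t hs ht
  -- the ∃! of the contraction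
  obtain ⟨s, -, huniq⟩ := propFive_fixedPoint_kLevel (Ω := Ω) (Eb := Eb) (U₀ := U₀) (A := A) (DA := fun y => covDivB η U₀ A y) hL hη
    (⇑g) R gpar Eterm hα₄ hBG hBR (by positivity) ha₁' hb₁ hb₁' hcA hcA' hcDA hh₂ hl₂ (by positivity) (by positivity) hθ hG
    (fun f f' => map_sub g f f') hRsub hRbd hg0 hg1 hgL hE0 hEL hDA hA h103 h106
  have e₁ : t₁ = s := huniq t₁ ⟨ht₁, hfix₁⟩
  have e₂ : t₂ = s := huniq t₂ ⟨ht₂, hfix₂⟩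
  rw [← hgp₁, ← hgp₂, e₁, e₂]

end Converse179

#print axioms isFixedPoint_of_cond179
#print axioms hFP_unique_of_cond179

end Literature.MathematicalPhysics.QuantumFieldTheory.Balaban1983to89.B8Prop5UniqKLevel

end
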